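import Mathlib.Analysis.Calculus.UniformLimitsDeriv
import Mathlib.Analysis.Calculus.Deriv.MeanValue
import Mathlib.Topology.UniformSpace.LocallyUniformConvergence
import Mathlib.Analysis.Analytic.Constructions
import Mathlib.Analysis.Analytic.Linear
import Mathlib.Analysis.Complex.LocallyUniformLimit
import Literature.Probability.LatticeModels.LeeYangFirstZeroLimitFromUrsell
import Literature.Probability.LatticeModels.IsingFKG
import Literature.Probability.LatticeModels.GHSInequality
import Literature.Probability.LatticeModels.SharpnessDecayProofs
import Literature.Probability.LatticeModels.TwistedPlusExpect
import HarnessLib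

/-!
# Thermodynamic limit of the first Lee–Yang zero (Jiang–Newman 2023) — JN Theorem 2:
# derivatives of the free energy below `β_c` (Lebowitz 1972 + Aizenman–Barsky–Fernández 1987)

Topic `Probability/LatticeModels`, namespace `Literature.Probability.LatticeModels.JiangNewman`.
Third PROOF file for the named fact `JiangNewman.FirstZeroLimit` of `LeeYangFirstZeroLimit.lean`
(J. Jiang, C. M. Newman, *Thermodynamic limit of the first Lee–Yang zero*, CPAM 77 (2024)
1224–1234 = arXiv:2210.03602 [JiangNewman2023]). Theorems only: no definition, no statement and no
named fact is introduced or changed.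

`LeeYangFirstZeroLimitFromUrsell.lean` reduced `FirstZeroLimit` to the three deep inputs of the
printed proof of JN Theorem 1 (`firstZeroLimit_of_thm1_of_analytic_of_tendsto`): Camia–Jiang–Newman's
Theorem 1 (the tree's named fact `CamiaJiangNewman2023_thm1`), Ott's analyticity of `f_β` at `h = 0`
for `β < β_c` [Ott20, Cor. 1.4], and **JN Theorem 2** ("[Leb72] and [ABF87]"): for
`β ∈ [0, β_c(d))`, `f_β ∈ C^∞(ℝ)` and `dᵏf_{B_n,β}/dhᵏ → dᵏf_β/dhᵏ` uniformly on compacts — used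
through its consequence `u_k(M_{B_n,β,0})/|B_n| = f_{B_n,β}^{(k)}(0) → f_β^{(k)}(0)` (JN (2.21)).
This file PROVES JN Theorem 2 from the tree (`tendstoUniformlyOn_iteratedDeriv_freeEnergyIn`,
`contDiff_freeEnergy`, `tendsto_magnetizationCumulant_div_card_of_lt_criticalBeta`), and records the
reduction of `FirstZeroLimit` to the two remaining inputs (`firstZeroLimit_of_thm1_of_analytic`).
It also records the analyticity input in Mathlib's standard vocabulary (section `AnalyticInput`):
`AnalyticOnDisc d β ρ` for some `ρ > 0` (a holomorphic extension of `f_β` to a complex disc about `0`)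
is EQUIVALENT to real analyticity of `f_β` at `0`, `AnalyticAt ℝ (freeEnergy d β) 0`
(`exists_analyticOnDisc_iff_analyticAt`: complexify the real power series, resp. restrict the
holomorphic extension to the real axis and take real parts), whence the reductions
`firstZeroLimit_of_thm1_of_analyticAt` (hypothesis: `h ↦ f_β(h)` real analytic at `0` for
`0 ≤ β < β_c(d)`, the `h`-slice of [Ott20, Cor. 1.4]) and `firstZeroLimit_of_thm1_of_analyticAt₂`
(hypothesis: `(β,h) ↦ f_β(h)` jointly real analytic at `(β,0)`, [Ott20, Cor. 1.4] as printed); and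
conversely `FirstZeroLimit` itself returns this analyticity (`FirstZeroLimit.analyticAt_freeEnergy`),
so the residual hypothesis is sharp.

## The printed proof and its rendering

JN, proof of Thm. 2: "It is proved in [Leb72] that `f_β` is infinitely differentiable in `h`
whenever the infinite-volume truncated two-point functions decay exponentially; the latter is proved
in [ABF87] … see Lemma II.12.9 of [Sim93] for the argument which leads to (2.8) by using the bounds
on the derivatives of `f_{B_n,β}` from [Leb72]."  We follow exactly this architecture.

1. **Derivatives are cumulants** (JN (2.2)–(2.3), at every real field):
   `(d/dh)ⁿ ln Z_{Λ,β,h}|_{h=t} = κ_n(M_Λ)` under `⟨·⟩^∅_{Λ;β,t/β}` — through the local complex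
   logarithm of `z ↦ Z(t+z)/Z(t)` and the tree's `iteratedDeriv_succ_eq_cumulantOf`
   (`iteratedDeriv_log_partitionFunction_eq_cumulantOf`); and `κ_n(M_Λ) = ∑_{x ∈ Λⁿ} u_n(σ_{x_1},
   …, σ_{x_n})` (multilinearity of the Möbius partition sum, `cumulantOf_pow_sum_eq`, the generic
   form of CJN eq. (14)).
2. **Lebowitz's bounds** [Leb72]: (a) FKG gives, for spin products `σ_S`, `σ_T` supported on index
   sets `S ⊆ A`, `T ⊆ Aᶜ`, `|⟨σ_Sσ_T⟩ - ⟨σ_S⟩⟨σ_T⟩| ≤ ∑_{i∈A, j∉A} ⟨σ_{x_i}; σ_{x_j}⟩` (the four FKG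
   inequalities for `M_A ± σ_S`, `M_{Aᶜ} ± σ_T`, `abs_cov_prod_le_cov_sum`); (b) GHS
   (`antitoneOn_isingTrunc_field`) and spin flip give `⟨σ_p;σ_q⟩_{Λ,h} ≤ ⟨σ_pσ_q⟩_{Λ,0}`, Griffiths'
   volume monotonicity and translation invariance give `≤ ⟨σ₀σ_{q-p}⟩^∅_β`, and ABF sharpness
   (`twoPoint_exponentialDecay_of_lt_criticalBeta_holds`) gives `≤ e^{-c‖q-p‖}` for `β < β_c`
   (`exists_isingTrunc_le_exp`); (c) the cluster bound: an almost factorising moment function has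
   a small Ursell function (`abs_ursellOf_le_of_almost_factorises`, from the tree's
   `ursellOf_eq_zero_of_factorises` and the explicit Möbius formula), so splitting the `n` points
   at a gap of order `diam/n` (pigeonhole, `exists_separated_bipartition`) yields
   `|u_n(σ_{x_0..x_{n-1}})| ≤ C_n e^{-(c/n)·diam}` and `∑_{x ∈ Λⁿ} |u_n| ≤ C_n |Λ|`
   (`exists_sum_abs_ursell_le`), i.e. `sup_{Λ,h} |f_{Λ,β}^{(n)}(h)| < ∞`
   (`exists_abs_iteratedDeriv_freeEnergyIn_le`).
3. **Simon's Lemma II.12.9** (`tendstoUniformlyOn_iteratedDeriv_of_bounds`, `contDiff_of_bounds`):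
   pointwise convergence `f_{B_n,β} → f_β` (clause (0), Friedli–Velenik Thm. 3.6) and uniform
   bounds on all derivatives give `C^∞` of the limit and locally uniform convergence of every
   derivative (equi-Lipschitz level `0`; the interpolation inequality `|ψ'| ≤ 2 sup|ψ|/ℓ + ℓ sup|ψ''|`
   makes the next derivatives uniformly Cauchy; the uniform limit of derivatives is the derivative,
   Mathlib's `hasDerivAt_of_tendstoLocallyUniformlyOn`).
The case `β = 0` (independent spins, `f_{Λ,0} = ln(e^h+e^{-h})` for every `Λ`) is immediate.

## References

* [JiangNewman2023] J. Jiang, C. M. Newman, CPAM 77 (2024) 1224–1234, arXiv:2210.03602: Thm. 2,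
  Prop. 3 eq. (2.21), Remark 4, §2 eqs. (2.2)–(2.4).
* [Lebowitz1972] J. L. Lebowitz, *Bounds on the correlations and analyticity properties of
  ferromagnetic Ising spin systems*, Comm. Math. Phys. 28 (1972) 313–321 (READ, held as
  `paper:doi-10-1007-bf01645632`): §I Lemma 1 eq. (1.7) (FKG bound `⟨ρ_Aρ_B⟩ - ⟨ρ_A⟩⟨ρ_B⟩ ≤
  ∑_{i∈A,j∈B} u_2(i,j)`), eqs. (1.9), (1.12)–(1.13) (decay of all Ursell functions dominated by the
  pair correlation), §II eqs. (2.4)–(2.7) (`dᵐψ/dhᵐ` as Ursell sums; `C^∞` under the exponential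
  bound (2.6)), §III Lemma 2 eq. (3.1) (`U_2(β,h;Λ,b_0) ≤ U_2(β,0;Λ,b_0) ≤` infinite volume, by GHS
  and Griffiths).
* [Simon1993] B. Simon, *The Statistical Mechanics of Lattice Gases*, Vol. I, Princeton 1993,
  §II.12, Lemma II.12.9.
* [AizenmanBarskyFernandezJSP1987] M. Aizenman, D. J. Barsky, R. Fernández, J. Stat. Phys. 47 (1987),
  Thm. 1 (tree: `twoPoint_exponentialDecay_of_lt_criticalBeta_holds`).
* [FriedliVelenik2017] Thm. 3.21 (FKG, tree `ising_fkg_holds`), §3.9 (GHS), Exercise 3.12,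
  Thm. 3.6; [CamiaJiangNewman2023] §1.2 eq. (14).
* [Ott2019] S. Ott, *Weak mixing and analyticity of the pressure in the Ising model*, Comm. Math.
  Phys. 377 (2020) 675–696, arXiv:1905.12928 (READ §1): Thm. 1.3 (weak mixing ⇒ the pressure is
  analytic, jointly in `(β,h)`), Cor. 1.4 (`h ≠ 0`, or `h = 0` and `β < β_c(d)`, any `d ≥ 1`); same
  normalisation `exp[β∑σσ + h∑σ]` of the field as Jiang–Newman.
-/

noncomputable section

open Filter Topology Finset

namespace Literature.Probability.LatticeModels

namespace JiangNewman

/-! ### Generic joint cumulants under a linear functional: multilinearity and the cluster bound -/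

section GenericCumulants

variable {Ω : Type*}

/-- One block factor `E(∏_{i ∈ B} Y_i)` is additive in the variable `Y_{i₀}`, `i₀ ∈ B`, for an
additive functional `E`. [folklore] -/
theorem map_prod_update_add (E : (Ω → ℝ) → ℝ) (hadd : ∀ f g, E (f + g) = E f + E g) {n : ℕ}
    (B : Finset (Fin n)) (Y : Fin n → Ω → ℝ) {i₀ : Fin n} (hi₀ : i₀ ∈ B) (Z Z' : Ω → ℝ) :
    E (fun ω => ∏ i ∈ B, Function.update Y i₀ (Z + Z') i ω) =
      E (fun ω => ∏ i ∈ B, Function.update Y i₀ Z i ω) +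
        E (fun ω => ∏ i ∈ B, Function.update Y i₀ Z' i ω) := by
  have key : ∀ W : Ω → ℝ, (fun ω => ∏ i ∈ B, Function.update Y i₀ W i ω) =
      fun ω => W ω * ∏ i ∈ B.erase i₀, Y i ω := by
    intro W
    funext ω
    rw [← mul_prod_erase B _ hi₀, Function.update_self]
    congr 1
    refine prod_congr rfl fun i hi => ?_
    rw [Function.update_of_ne (ne_of_mem_erase hi)]
  rw [key, key, key, ← hadd]
  congr 1
  funext ω
  simp only [Pi.add_apply]
  ring

/-- One block factor is homogeneous in the variable `Y_{i₀}`, `i₀ ∈ B`. [folklore] -/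
theorem map_prod_update_smul (E : (Ω → ℝ) → ℝ) (hsmul : ∀ (c : ℝ) f, E (c • f) = c * E f) {n : ℕ}
    (B : Finset (Fin n)) (Y : Fin n → Ω → ℝ) {i₀ : Fin n} (hi₀ : i₀ ∈ B) (r : ℝ) (Z : Ω → ℝ) :
    E (fun ω => ∏ i ∈ B, Function.update Y i₀ (r • Z) i ω) =
      r * E (fun ω => ∏ i ∈ B, Function.update Y i₀ Z i ω) := by
  have key : ∀ W : Ω → ℝ, (fun ω => ∏ i ∈ B, Function.update Y i₀ W i ω) =
      fun ω => W ω * ∏ i ∈ B.erase i₀, Y i ω := by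
    intro W
    funext ω
    rw [← mul_prod_erase B _ hi₀, Function.update_self]
    congr 1
    refine prod_congr rfl fun i hi => ?_
    rw [Function.update_of_ne (ne_of_mem_erase hi)]
  rw [key, key, ← hsmul]
  congr 1
  funext ω
  simp only [Pi.smul_apply, smul_eq_mul]
  ring

/-- A block not containing `i₀` does not see the variable `Y_{i₀}`. [folklore] -/
theorem prod_update_of_not_mem' {n : ℕ} (B : Finset (Fin n)) (Y : Fin n → Ω → ℝ) {i₀ : Fin n}
    (hi₀ : i₀ ∉ B) (W : Ω → ℝ) (ω : Ω) :
    ∏ i ∈ B, Function.update Y i₀ W i ω = ∏ i ∈ B, Y i ω := by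
  refine prod_congr rfl fun i hi => ?_
  rw [Function.update_of_ne]
  rintro rfl
  exact hi₀ hi

/-- Splitting off the block of `i₀` in the product over the blocks of a partition. [folklore] -/
theorem prod_parts_update_eq' (E : (Ω → ℝ) → ℝ) {n : ℕ}
    (P : Finpartition (univ : Finset (Fin n))) (Y : Fin n → Ω → ℝ) (i₀ : Fin n)
    {B₀ : Finset (Fin n)} (hB₀ : B₀ ∈ P.parts) (hi₀ : i₀ ∈ B₀) (W : Ω → ℝ) :
    ∏ B ∈ P.parts, E (fun ω => ∏ i ∈ B, Function.update Y i₀ W i ω) =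
      E (fun ω => ∏ i ∈ B₀, Function.update Y i₀ W i ω) *
        ∏ B ∈ P.parts.erase B₀, E (fun ω => ∏ i ∈ B, Y i ω) := by
  rw [← mul_prod_erase P.parts _ hB₀]
  congr 1
  refine prod_congr rfl fun B hB => ?_
  obtain ⟨hne, hB⟩ := mem_erase.1 hB
  have hi₀B : i₀ ∉ B := fun h => hne (P.eq_of_mem_parts hB hB₀ h hi₀)
  congr 1
  funext ω
  exact prod_update_of_not_mem' B Y hi₀B W ω

/-- **The partition (Möbius) sum is multilinear in the observables**, for any additive and
homogeneous functional `E` (each variable sits in exactly one block of each partition).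
[cite: CamiaJiangNewman2023, §1.2 eq. (14)] -/
theorem exists_multilinearMap_partitionSum (E : (Ω → ℝ) → ℝ) (hadd : ∀ f g, E (f + g) = E f + E g)
    (hsmul : ∀ (c : ℝ) f, E (c • f) = c * E f) (n : ℕ) :
    ∃ F : MultilinearMap ℝ (fun _ : Fin n => Ω → ℝ) ℝ,
      ∀ Y : Fin n → Ω → ℝ, F Y = ∑ P : Finpartition (univ : Finset (Fin n)),
        (-1 : ℝ) ^ (P.parts.card - 1) * ((P.parts.card - 1).factorial : ℝ) *
          ∏ B ∈ P.parts, E (fun ω => ∏ i ∈ B, Y i ω) := by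
  classical
  refine ⟨MultilinearMap.mk (fun Y => ∑ P : Finpartition (univ : Finset (Fin n)),
        (-1 : ℝ) ^ (P.parts.card - 1) * ((P.parts.card - 1).factorial : ℝ) *
          ∏ B ∈ P.parts, E (fun ω => ∏ i ∈ B, Y i ω)) ?_ ?_, fun Y => rfl⟩
  · intro inst Y i₀ Z Z'
    have hinst : inst = instDecidableEqFin n := Subsingleton.elim _ _
    subst hinst
    rw [← sum_add_distrib]
    refine sum_congr rfl fun P _ => ?_
    obtain ⟨B₀, hB₀, hi₀⟩ := P.exists_mem (mem_univ i₀)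
    rw [prod_parts_update_eq' E P Y i₀ hB₀ hi₀, prod_parts_update_eq' E P Y i₀ hB₀ hi₀,
      prod_parts_update_eq' E P Y i₀ hB₀ hi₀, map_prod_update_add E hadd B₀ Y hi₀]
    ring
  · intro inst Y i₀ r Z
    have hinst : inst = instDecidableEqFin n := Subsingleton.elim _ _
    subst hinst
    rw [smul_eq_mul, mul_sum]
    refine sum_congr rfl fun P _ => ?_
    obtain ⟨B₀, hB₀, hi₀⟩ := P.exists_mem (mem_univ i₀)
    rw [prod_parts_update_eq' E P Y i₀ hB₀ hi₀, prod_parts_update_eq' E P Y i₀ hB₀ hi₀,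
      map_prod_update_smul E hsmul B₀ Y hi₀]
    ring

/-- **Multilinear expansion of the partition sum of a linear observable**
`X = ∑_u a_u Z_u`: `∑_P c_P ∏_{B∈P} E(X^{|B|}) = ∑_{j : [n] → U} (∏_i a_{j_i}) ∑_P c_P ∏_B E(∏_{i∈B} Z_{j_i})`.
[cite: CamiaJiangNewman2023, §1.2 eq. (14)] -/
theorem partitionSum_pow_sum_eq (E : (Ω → ℝ) → ℝ) (hadd : ∀ f g, E (f + g) = E f + E g)
    (hsmul : ∀ (c : ℝ) f, E (c • f) = c * E f) {U : Type*} [Fintype U] (a : U → ℝ)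
    (Z : U → Ω → ℝ) (n : ℕ) :
    ∑ P : Finpartition (univ : Finset (Fin n)),
        (-1 : ℝ) ^ (P.parts.card - 1) * ((P.parts.card - 1).factorial : ℝ) *
          ∏ B ∈ P.parts, E (fun ω => (∑ u, a u * Z u ω) ^ B.card) =
      ∑ j : Fin n → U, (∏ i, a (j i)) *
        ∑ P : Finpartition (univ : Finset (Fin n)),
          (-1 : ℝ) ^ (P.parts.card - 1) * ((P.parts.card - 1).factorial : ℝ) *
            ∏ B ∈ P.parts, E (fun ω => ∏ i ∈ B, Z (j i) ω) := by
  obtain ⟨F, hF⟩ := exists_multilinearMap_partitionSum E hadd hsmul n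
  have hX : (fun (_ : Fin n) (ω : Ω) => ∑ u, a u * Z u ω) =
      fun i => ∑ u : U, (fun (_ : Fin n) (u : U) => a u • Z u) i u := by
    funext i ω
    simp only [Finset.sum_apply, Pi.smul_apply, smul_eq_mul]
  have hL : ∑ P : Finpartition (univ : Finset (Fin n)),
        (-1 : ℝ) ^ (P.parts.card - 1) * ((P.parts.card - 1).factorial : ℝ) *
          ∏ B ∈ P.parts, E (fun ω => (∑ u, a u * Z u ω) ^ B.card) =
      F (fun _ ω => ∑ u, a u * Z u ω) := by
    rw [hF]
    simp_rw [prod_const]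
  rw [hL, hX, F.map_sum]
  refine sum_congr rfl fun j _ => ?_
  rw [F.map_smul_univ, hF, smul_eq_mul]

/-- **Cumulants of a linear observable through joint cumulants** (for a normalised linear
functional `E`, `E 1 = 1`): for `n ≥ 1`,
`κ_n(X) = ∑_{j : [n] → U} (∏_i a_{j_i}) · uᵀ(Z_{j_0}, …, Z_{j_{n-1}})`, the joint cumulant being
`ursellOf` of the moment function `S ↦ E(∏_{i∈S} Z_{j_i})`. [cite: CamiaJiangNewman2023, §1.2 eq. (14)] -/
theorem cumulantOf_pow_sum_eq (E : (Ω → ℝ) → ℝ) (hadd : ∀ f g, E (f + g) = E f + E g)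
    (hsmul : ∀ (c : ℝ) f, E (c • f) = c * E f) (hE1 : E (fun _ => 1) = 1)
    {U : Type*} [Fintype U] (a : U → ℝ) (Z : U → Ω → ℝ) {n : ℕ} (hn : 0 < n) :
    cumulantOf (fun m => E (fun ω => (∑ u, a u * Z u ω) ^ m)) n =
      ∑ j : Fin n → U, (∏ i, a (j i)) *
        ursellOf (fun S : Finset (Fin n) => E (fun ω => ∏ i ∈ S, Z (j i) ω)) univ := by
  have h0 : (fun m => E (fun ω => (∑ u, a u * Z u ω) ^ m)) 0 = 1 := by simpa using hE1
  rw [cumulantOf_eq_sum_finpartition _ h0 hn, partitionSum_pow_sum_eq E hadd hsmul a Z n]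
  refine sum_congr rfl fun j _ => ?_
  rw [ursellOf_univ_eq_sum_finpartition _ (by simpa using hE1) hn]

/-- Telescoping: for factors bounded by `1`, `|∏ a - ∏ b| ≤ ∑ |a_i - b_i|`. [folklore] -/
theorem abs_prod_sub_prod_le {α : Type*} [DecidableEq α] (s : Finset α) {a b : α → ℝ}
    (ha : ∀ i ∈ s, |a i| ≤ 1) (hb : ∀ i ∈ s, |b i| ≤ 1) :
    |∏ i ∈ s, a i - ∏ i ∈ s, b i| ≤ ∑ i ∈ s, |a i - b i| := by
  induction s using Finset.induction_on with
  | empty => simp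
  | insert x s hx ih =>
    rw [prod_insert hx, prod_insert hx, sum_insert hx]
    have ha' : ∀ i ∈ s, |a i| ≤ 1 := fun i hi => ha i (mem_insert_of_mem hi)
    have hb' : ∀ i ∈ s, |b i| ≤ 1 := fun i hi => hb i (mem_insert_of_mem hi)
    have hax : |a x| ≤ 1 := ha x (mem_insert_self x s)
    have hpb : |∏ i ∈ s, b i| ≤ 1 := by
      rw [Finset.abs_prod]
      exact prod_le_one (fun i _ => abs_nonneg _) hb'
    have hsplit : a x * ∏ i ∈ s, a i - b x * ∏ i ∈ s, b i =
        a x * (∏ i ∈ s, a i - ∏ i ∈ s, b i) + (a x - b x) * ∏ i ∈ s, b i := by ring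
    rw [hsplit]
    refine (abs_add_le _ _).trans ?_
    rw [abs_mul, abs_mul, add_comm]
    refine add_le_add ?_ ?_
    · calc |a x - b x| * |∏ i ∈ s, b i| ≤ |a x - b x| * 1 :=
            mul_le_mul_of_nonneg_left hpb (abs_nonneg _)
        _ = |a x - b x| := mul_one _
    · calc |a x| * |∏ i ∈ s, a i - ∏ i ∈ s, b i| ≤ 1 * |∏ i ∈ s, a i - ∏ i ∈ s, b i| :=
            mul_le_mul_of_nonneg_right hax (abs_nonneg _)
        _ ≤ ∑ i ∈ s, |a i - b i| := by rw [one_mul]; exact ih ha' hb'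

/-- **The cluster bound for joint cumulants.** If a moment function `m` on the subsets of `[n]`
(`m ∅ = 1`, `|m| ≤ 1`) almost factorises over a bipartition `A ⊔ Aᶜ` of `[n]` into two nonempty
parts, `|m(S) - m(S ∩ A) m(S \ A)| ≤ ε` for all `S`, then its Ursell function is small:
`|mᵀ([n])| ≤ L_n ε` with `L_n = ∑_π (|π|-1)! |π|` (the exactly factorised moment function has
vanishing Ursell function, `ursellOf_eq_zero_of_factorises`, and the Möbius polynomial is
`L_n`-Lipschitz on the unit cube). This is the mechanism of Lebowitz 1972 / Duneau–Iagolnitzer–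
Souillard by which clustering of covariances yields decay of all truncated functions
(Lebowitz 1972, §I, the step from (1.9) to (1.12): "for any partition of the set `{i_1,…,i_ℓ}`
into two disjoint sets `A` and `B`, `U_ℓ` can be written as a finite sum of terms each having
the form `(±1) ∏ ⟨ρ_{X_α}⟩ [⟨ρ_{A'}ρ_{B'}⟩ - ⟨ρ_{A'}⟩⟨ρ_{B'}⟩]`").
[cite: Lebowitz1972, §I eqs. (1.9)–(1.12)] -/
theorem abs_ursellOf_le_of_almost_factorises {n : ℕ} (m : Finset (Fin n) → ℝ) (hm0 : m ∅ = 1)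
    (hm1 : ∀ S, |m S| ≤ 1) (A : Finset (Fin n)) (hA : A.Nonempty) (hAc : (univ \ A).Nonempty)
    {ε : ℝ} (hε : ∀ S, |m S - m (S ∩ A) * m (S \ A)| ≤ ε) :
    |ursellOf m univ| ≤
      (∑ π ∈ setPartitions (univ : Finset (Fin n)),
        (((π.card - 1).factorial : ℝ) * π.card)) * ε := by
  classical
  have hn : (univ : Finset (Fin n)).Nonempty := hA.mono (subset_univ A)
  -- the factorised moment function
  set m' : Finset (Fin n) → ℝ := fun S => m (S ∩ A) * m (S \ A) with hm'
  have hm'0 : m' ∅ = 1 := by simp [hm', hm0]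
  have hm'1 : ∀ S, |m' S| ≤ 1 := fun S => by
    rw [hm', abs_mul]
    exact mul_le_one₀ (hm1 _) (abs_nonneg _) (hm1 _)
  have hfact : ∀ P ⊆ A, ∀ Q ⊆ univ \ A, m' (P ∪ Q) = m' P * m' Q := by
    intro P hP Q hQ
    have hQA : Disjoint Q A := by
      rw [Finset.disjoint_left]
      intro x hxQ hxA
      exact (mem_sdiff.1 (hQ hxQ)).2 hxA
    have h1 : (P ∪ Q) ∩ A = P := by
      rw [union_inter_distrib_right, inter_eq_left.2 hP, Finset.disjoint_iff_inter_eq_empty.1 hQA,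
        union_empty]
    have h2 : (P ∪ Q) \ A = Q := by
      rw [union_sdiff_distrib, Finset.sdiff_eq_empty_iff_subset.2 hP, empty_union,
        sdiff_eq_self_of_disjoint hQA]
    have h3 : P ∩ A = P := inter_eq_left.2 hP
    have h4 : P \ A = ∅ := Finset.sdiff_eq_empty_iff_subset.2 hP
    have h5 : Q ∩ A = ∅ := Finset.disjoint_iff_inter_eq_empty.1 hQA
    have h6 : Q \ A = Q := sdiff_eq_self_of_disjoint hQA
    simp only [hm', h1, h2, h3, h4, h5, h6, hm0, mul_one, one_mul]
  have hzero : ursellOf m' univ = 0 := by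
    refine ursellOf_eq_zero_of_factorises m' hm'0 (A := A) (B := univ \ A) disjoint_sdiff hfact
      (V := univ) ?_ ?_ ?_
    · rw [union_sdiff_of_subset (subset_univ A)]
    · rwa [univ_inter]
    · rwa [univ_inter]
  have hexp := ursellOf_eq_sum_setPartitions m hm0 hn
  have hexp' := ursellOf_eq_sum_setPartitions m' hm'0 hn
  have hdiff : ursellOf m univ = ∑ π ∈ setPartitions (univ : Finset (Fin n)),
      (-1 : ℝ) ^ (π.card - 1) * ((π.card - 1).factorial : ℝ) *
        (∏ P ∈ π, m P - ∏ P ∈ π, m' P) := by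
    rw [← sub_zero (ursellOf m univ), ← hzero, hexp, hexp', ← sum_sub_distrib]
    refine sum_congr rfl fun π _ => ?_
    ring
  rw [hdiff, sum_mul]
  refine (abs_sum_le_sum_abs _ _).trans (sum_le_sum fun π _ => ?_)
  rw [abs_mul, abs_mul, abs_pow, abs_neg, abs_one, one_pow, one_mul, Nat.abs_cast]
  rw [mul_assoc]
  refine mul_le_mul_of_nonneg_left ?_ (Nat.cast_nonneg _)
  calc |∏ P ∈ π, m P - ∏ P ∈ π, m' P| ≤ ∑ P ∈ π, |m P - m' P| :=
        abs_prod_sub_prod_le π (fun P _ => hm1 P) (fun P _ => hm'1 P)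
    _ ≤ ∑ P ∈ π, ε := sum_le_sum fun P _ => hε P
    _ = π.card * ε := by rw [sum_const, nsmul_eq_mul]

end GenericCumulants


/-! ### Lebowitz's FKG bound on covariances of spin products -/

section Lebowitz

variable {V : Type*} (G : SimpleGraph V) [DecidableEq V] [G.LocallyFinite]

/-- Linearity of finite-volume Gibbs averages on a countable graph (all observables). [folklore] -/
theorem isingExpect_add_of_countable [Countable V] (Λ : Finset V) (β h : ℝ) (bc : BoundaryCondition V)
    (f g : SpinConfig V → ℝ) :
    isingExpect G Λ β h bc (f + g) = isingExpect G Λ β h bc f + isingExpect G Λ β h bc g := by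
  rw [isingExpect_eq_sum_div_of_countable, isingExpect_eq_sum_div_of_countable,
    isingExpect_eq_sum_div_of_countable, ← add_div, ← sum_add_distrib]
  congr 1
  exact sum_congr rfl fun τ _ => by simp only [Pi.add_apply]; ring

/-- Homogeneity of finite-volume Gibbs averages on a countable graph (all observables). [folklore] -/
theorem isingExpect_smul_of_countable [Countable V] (Λ : Finset V) (β h : ℝ) (bc : BoundaryCondition V)
    (c : ℝ) (f : SpinConfig V → ℝ) :
    isingExpect G Λ β h bc (c • f) = c * isingExpect G Λ β h bc f := by
  rw [isingExpect_eq_sum_div_of_countable, isingExpect_eq_sum_div_of_countable, mul_div_assoc',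
    mul_sum]
  congr 1
  exact sum_congr rfl fun τ _ => by simp only [Pi.smul_apply, smul_eq_mul]; ring

/-- `⟨f - g⟩ = ⟨f⟩ - ⟨g⟩` on a countable graph. [folklore] -/
theorem isingExpect_sub_of_countable [Countable V] (Λ : Finset V) (β h : ℝ) (bc : BoundaryCondition V)
    (f g : SpinConfig V → ℝ) :
    isingExpect G Λ β h bc (f - g) = isingExpect G Λ β h bc f - isingExpect G Λ β h bc g := by
  have h1 : f - g = f + (-1 : ℝ) • g := by
    funext σ; simp only [Pi.sub_apply, Pi.add_apply, Pi.smul_apply, smul_eq_mul]; ring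
  rw [h1, isingExpect_add_of_countable, isingExpect_smul_of_countable]
  ring

/-- `|⟨f⟩| ≤ 1` for `|f| ≤ 1`, countable graph. [folklore] -/
theorem abs_isingExpect_le_one_of_countable [Countable V] (Λ : Finset V) (β h : ℝ)
    (bc : BoundaryCondition V) {f : SpinConfig V → ℝ} (hf : ∀ σ, |f σ| ≤ 1) :
    |isingExpect G Λ β h bc f| ≤ 1 := by
  rw [isingExpect_eq_sum_div_of_countable, abs_div, abs_of_pos (isingPartitionFunction_pos G Λ β h bc),
    div_le_one (isingPartitionFunction_pos G Λ β h bc), isingPartitionFunction]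
  refine (abs_sum_le_sum_abs _ _).trans (sum_le_sum fun τ _ => ?_)
  rw [abs_mul, abs_of_pos (isingWeight_pos G Λ β h bc τ)]
  calc isingWeight G Λ β h bc τ * |f (glue Λ τ bc)| ≤ isingWeight G Λ β h bc τ * 1 :=
        mul_le_mul_of_nonneg_left (hf _) (isingWeight_pos G Λ β h bc τ).le
    _ = isingWeight G Λ β h bc τ := mul_one _

omit [DecidableEq V] [G.LocallyFinite] in
/-- A spin product over an index set is bounded by `1`. [folklore] -/
theorem abs_prod_spinAt_le_one {ι : Type*} (S : Finset ι) (x : ι → V) (σ : SpinConfig V) :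
    |∏ i ∈ S, spinAt (x i) σ| ≤ 1 := by
  rw [Finset.abs_prod]
  exact prod_le_one (fun i _ => abs_nonneg _) fun i _ => (abs_spinAt (x i) σ).le

omit [DecidableEq V] [G.LocallyFinite] in
/-- **Lebowitz's device**: for `T ⊆ A` and `s = ±1`, the observable
`∑_{i ∈ A} σ_{x_i} + s ∏_{i ∈ T} σ_{x_i}` is nondecreasing (flipping spins up changes the
product by at most `2`, and then some `σ_{x_i}`, `i ∈ A`, increased by `2`; Lebowitz: "`S_A`,
`ρ_A` and `S_A - ρ_A` are non-negative monotone functions", here in spin variables).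
[cite: Lebowitz1972, §I Lemma 1, eqs. (1.4)–(1.7)] -/
theorem monotone_sum_spinAt_add_sign_mul_prod {n : ℕ} (x : Fin n → V) {A T : Finset (Fin n)}
    (hTA : T ⊆ A) {s : ℝ} (hs : s = 1 ∨ s = -1) :
    Monotone fun σ : SpinConfig V => ∑ i ∈ A, spinAt (x i) σ + s * ∏ i ∈ T, spinAt (x i) σ := by
  intro σ σ' hle
  have hmono : ∀ i, spinAt (x i) σ ≤ spinAt (x i) σ' := fun i => spinAt_mono (x i) hle
  have hsum : ∀ i ∈ A, spinAt (x i) σ' - spinAt (x i) σ ≤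
      ∑ j ∈ A, (spinAt (x j) σ' - spinAt (x j) σ) := fun i hi =>
    single_le_sum (fun j _ => sub_nonneg.2 (hmono j)) hi
  have hs1 : |s| = 1 := by rcases hs with rfl | rfl <;> simp
  dsimp only
  by_cases hT : ∃ i ∈ T, spinAt (x i) σ ≠ spinAt (x i) σ'
  · obtain ⟨i, hiT, hne⟩ := hT
    -- the spin at `x i` flipped from `-1` to `+1`
    have hgap : spinAt (x i) σ' - spinAt (x i) σ = 2 := by
      rcases spinAt_eq_one_or_eq_neg_one (x i) σ with h1 | h1 <;>
        rcases spinAt_eq_one_or_eq_neg_one (x i) σ' with h2 | h2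
      · exact absurd (h1.trans h2.symm) hne
      · have := hmono i; rw [h1, h2] at this; norm_num at this
      · rw [h1, h2]; norm_num
      · exact absurd (h1.trans h2.symm) hne
    have h2 : (2 : ℝ) ≤ ∑ j ∈ A, (spinAt (x j) σ' - spinAt (x j) σ) := hgap ▸ hsum i (hTA hiT)
    have hp : |s * ∏ i ∈ T, spinAt (x i) σ' - s * ∏ i ∈ T, spinAt (x i) σ| ≤ 2 := by
      rw [← mul_sub, abs_mul, hs1, one_mul]
      calc |∏ i ∈ T, spinAt (x i) σ' - ∏ i ∈ T, spinAt (x i) σ|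
          ≤ |∏ i ∈ T, spinAt (x i) σ'| + |∏ i ∈ T, spinAt (x i) σ| := abs_sub _ _
        _ ≤ 1 + 1 := add_le_add (abs_prod_spinAt_le_one T x σ') (abs_prod_spinAt_le_one T x σ)
        _ = 2 := by norm_num
    rw [sum_sub_distrib] at h2
    have := neg_abs_le (s * ∏ i ∈ T, spinAt (x i) σ' - s * ∏ i ∈ T, spinAt (x i) σ)
    linarith
  · push Not at hT
    have hprod : ∏ i ∈ T, spinAt (x i) σ = ∏ i ∈ T, spinAt (x i) σ' :=
      prod_congr rfl fun i hi => hT i hi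
    rw [hprod]
    exact add_le_add (sum_le_sum fun i _ => hmono i) le_rfl

/-- **Lebowitz's FKG bound on the covariance of two spin products** (Lebowitz 1972): in any finite
volume, for `β ≥ 0`, any field and boundary condition, and index sets `S ⊆ A`, `T ⊆ [n] ∖ A`,
`|⟨σ_S σ_T⟩ - ⟨σ_S⟩⟨σ_T⟩| ≤ ⟨M_A M_B⟩ - ⟨M_A⟩⟨M_B⟩` with `M_A = ∑_{i∈A} σ_{x_i}`,
`M_B = ∑_{i∉A} σ_{x_i}` (FKG applied to the four pairs of nondecreasing observables `M_A ± σ_S`,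
`M_B ± σ_T`; Lebowitz's Lemma 1, `0 ≤ ⟨ρ_Aρ_B⟩ - ⟨ρ_A⟩⟨ρ_B⟩ ≤ ⟨S_AS_B⟩ - ⟨S_A⟩⟨S_B⟩ =
∑_{i∈A,j∈B} u_2(i,j)`, in spin variables). [cite: Lebowitz1972, §I Lemma 1, eq. (1.7)] -/
theorem abs_cov_prod_le_cov_sum [Countable V] {β : ℝ} (hβ : 0 ≤ β) (Λ : Finset V) (h : ℝ)
    (bc : BoundaryCondition V) {n : ℕ} (x : Fin n → V) (A : Finset (Fin n)) {S T : Finset (Fin n)}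
    (hS : S ⊆ A) (hT : T ⊆ univ \ A) :
    |isingExpect G Λ β h bc (fun σ => (∏ i ∈ S, spinAt (x i) σ) * ∏ i ∈ T, spinAt (x i) σ) -
        isingExpect G Λ β h bc (fun σ => ∏ i ∈ S, spinAt (x i) σ) *
          isingExpect G Λ β h bc (fun σ => ∏ i ∈ T, spinAt (x i) σ)| ≤
      isingExpect G Λ β h bc (fun σ => (∑ i ∈ A, spinAt (x i) σ) * ∑ i ∈ univ \ A, spinAt (x i) σ) -
        isingExpect G Λ β h bc (fun σ => ∑ i ∈ A, spinAt (x i) σ) *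
          isingExpect G Λ β h bc (fun σ => ∑ i ∈ univ \ A, spinAt (x i) σ) := by
  set E := isingExpect G Λ β h bc with hE
  set f : SpinConfig V → ℝ := fun σ => ∏ i ∈ S, spinAt (x i) σ with hf
  set g : SpinConfig V → ℝ := fun σ => ∏ i ∈ T, spinAt (x i) σ with hg
  set M : SpinConfig V → ℝ := fun σ => ∑ i ∈ A, spinAt (x i) σ with hM
  set N : SpinConfig V → ℝ := fun σ => ∑ i ∈ univ \ A, spinAt (x i) σ with hN
  have hfkg := ising_fkg_holds (G := G) (β := β) hβ Λ h bc
  -- measurability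
  have mf : Measurable f := Finset.measurable_prod _ fun i _ => measurable_spinAt (x i)
  have mg : Measurable g := Finset.measurable_prod _ fun i _ => measurable_spinAt (x i)
  have mM : Measurable M := Finset.measurable_sum _ fun i _ => measurable_spinAt (x i)
  have mN : Measurable N := Finset.measurable_sum _ fun i _ => measurable_spinAt (x i)
  -- the four FKG inequalities
  have key : ∀ s t : ℝ, (s = 1 ∨ s = -1) → (t = 1 ∨ t = -1) →
      E (fun σ => M σ + s * f σ) * E (fun σ => N σ + t * g σ) ≤
        E ((fun σ => M σ + s * f σ) * fun σ => N σ + t * g σ) := by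
    intro s t hs ht
    exact hfkg _ _ (monotone_sum_spinAt_add_sign_mul_prod x hS hs)
      (monotone_sum_spinAt_add_sign_mul_prod x hT ht) (mM.add (mf.const_mul s))
      (mN.add (mg.const_mul t))
  -- linearity bookkeeping
  have hlin : ∀ s t : ℝ, E ((fun σ => M σ + s * f σ) * fun σ => N σ + t * g σ) -
      E (fun σ => M σ + s * f σ) * E (fun σ => N σ + t * g σ) =
      (E (M * N) - E M * E N) + t * (E (M * g) - E M * E g) + s * (E (f * N) - E f * E N) +
        s * t * (E (f * g) - E f * E g) := by
    intro s t
    have e1 : ((fun σ => M σ + s * f σ) * fun σ => N σ + t * g σ) =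
        M * N + t • (M * g) + s • (f * N) + (s * t) • (f * g) := by
      funext σ; simp only [Pi.mul_apply, Pi.add_apply, Pi.smul_apply, smul_eq_mul]; ring
    have e2 : (fun σ => M σ + s * f σ) = M + s • f := by
      funext σ; simp only [Pi.add_apply, Pi.smul_apply, smul_eq_mul]
    have e3 : (fun σ => N σ + t * g σ) = N + t • g := by
      funext σ; simp only [Pi.add_apply, Pi.smul_apply, smul_eq_mul]
    rw [e1, e2, e3]
    simp only [hE, isingExpect_add_of_countable, isingExpect_smul_of_countable]
    ring
  have h1 := key 1 1 (Or.inl rfl) (Or.inl rfl)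
  have h2 := key (-1) (-1) (Or.inr rfl) (Or.inr rfl)
  have h3 := key 1 (-1) (Or.inl rfl) (Or.inr rfl)
  have h4 := key (-1) 1 (Or.inr rfl) (Or.inl rfl)
  rw [← sub_nonneg, hlin] at h1 h2 h3 h4
  have hfg : (fun σ => (∏ i ∈ S, spinAt (x i) σ) * ∏ i ∈ T, spinAt (x i) σ) = f * g := by
    funext σ; rfl
  have hMN : (fun σ => (∑ i ∈ A, spinAt (x i) σ) * ∑ i ∈ univ \ A, spinAt (x i) σ) = M * N := by
    funext σ; rfl
  rw [hfg, hMN]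
  change |E (f * g) - E f * E g| ≤ E (M * N) - E M * E N
  rw [abs_le]
  constructor <;> nlinarith [h1, h2, h3, h4]

/-- The covariance of two index sums is the double sum of the pair covariances. [folklore] -/
theorem cov_sum_sum_eq [Countable V] (Λ : Finset V) (β h : ℝ) (bc : BoundaryCondition V) {n : ℕ}
    (x : Fin n → V) (A B : Finset (Fin n)) :
    isingExpect G Λ β h bc (fun σ => (∑ i ∈ A, spinAt (x i) σ) * ∑ j ∈ B, spinAt (x j) σ) -
        isingExpect G Λ β h bc (fun σ => ∑ i ∈ A, spinAt (x i) σ) *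
          isingExpect G Λ β h bc (fun σ => ∑ j ∈ B, spinAt (x j) σ) =
      ∑ i ∈ A, ∑ j ∈ B, (isingExpect G Λ β h bc (fun σ => spinAt (x i) σ * spinAt (x j) σ) -
        isingExpect G Λ β h bc (spinAt (x i)) * isingExpect G Λ β h bc (spinAt (x j))) := by
  have hsum : ∀ (s : Finset (Fin n)) (F : Fin n → SpinConfig V → ℝ),
      isingExpect G Λ β h bc (fun σ => ∑ i ∈ s, F i σ) = ∑ i ∈ s, isingExpect G Λ β h bc (F i) := by
    intro s F
    induction s using Finset.induction_on with
    | empty => simpa using isingExpect_const G Λ β h bc 0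
    | insert i s hi ih =>
      simp only [sum_insert hi]
      rw [← ih, ← isingExpect_add_of_countable]
      rfl
  have e1 : (fun σ => (∑ i ∈ A, spinAt (x i) σ) * ∑ j ∈ B, spinAt (x j) σ) =
      fun σ => ∑ i ∈ A, ∑ j ∈ B, spinAt (x i) σ * spinAt (x j) σ := by
    funext σ; rw [sum_mul_sum]
  rw [e1, hsum A, hsum A (fun i σ => spinAt (x i) σ), hsum B (fun j σ => spinAt (x j) σ), sum_mul]
  rw [← sum_sub_distrib]
  refine sum_congr rfl fun i _ => ?_
  rw [hsum B (fun j σ => spinAt (x i) σ * spinAt (x j) σ), mul_sum, ← sum_sub_distrib]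

end Lebowitz

/-! ### The pair covariances: GHS, spin flip, Griffiths and exponential decay below `β_c` -/

section PairCovariance

variable {d : ℕ}

/-- **The truncated pair function is dominated by the zero-field two-point function**:
`⟨σ_pσ_q⟩^∅_{Λ;β,h} - ⟨σ_p⟩⟨σ_q⟩ ≤ ⟨σ_pσ_q⟩^∅_{Λ;β,0}` for `β ≥ 0`, every real `h` and
`p, q ∈ Λ` (GHS monotonicity in `h ≥ 0`, `antitoneOn_isingTrunc_field`, the vanishing of `⟨σ_p⟩` at
`h = 0`, and the spin-flip symmetry `h ↦ -h`; Lebowitz's Lemma 2, first inequality of (3.1):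
"`U_2(i,j;β,h;Λ,b_0) ≤ U_2(i,j;β,0;Λ,b_0)` … follows from the work of Griffiths, Hurst and
Sherman"). [cite: Lebowitz1972, §III Lemma 2, eqs. (3.1)–(3.2)] -/
theorem isingTrunc_le_zero_field {β : ℝ} (hβ : 0 ≤ β) (Λ : Finset (Site d)) (h : ℝ) {p q : Site d}
    (hp : p ∈ Λ) (hq : q ∈ Λ) :
    isingExpect (zdGraph d) Λ β h .free (fun σ => spinAt p σ * spinAt q σ) -
        isingExpect (zdGraph d) Λ β h .free (spinAt p) * isingExpect (zdGraph d) Λ β h .free (spinAt q) ≤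
      isingExpect (zdGraph d) Λ β 0 .free (fun σ => spinAt p σ * spinAt q σ) := by
  -- reduce to `h ≥ 0` by spin flip
  have hzero : isingExpect (zdGraph d) Λ β 0 .free (spinAt p) = 0 := by
    have := isingCorr_free_singleton_zero_field (zdGraph d) Λ β hp
    rwa [isingCorr, spinProduct_singleton] at this
  have hpos : ∀ h' : ℝ, 0 ≤ h' →
      isingExpect (zdGraph d) Λ β h' .free (fun σ => spinAt p σ * spinAt q σ) -
        isingExpect (zdGraph d) Λ β h' .free (spinAt p) * isingExpect (zdGraph d) Λ β h' .free (spinAt q) ≤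
      isingExpect (zdGraph d) Λ β 0 .free (fun σ => spinAt p σ * spinAt q σ) := by
    intro h' hh'
    have hanti := antitoneOn_isingTrunc_field (zdGraph d) hβ (Or.inl rfl) hp hq
      (Set.mem_Ici.2 le_rfl) (Set.mem_Ici.2 hh') hh'
    simp only at hanti
    rw [hzero, zero_mul, sub_zero] at hanti
    exact hanti
  rcases le_or_gt 0 h with hh | hh
  · exact hpos h hh
  · -- `h < 0`: flip all spins
    have hflip2 : isingExpect (zdGraph d) Λ β h .free (fun σ => spinAt p σ * spinAt q σ) =
        isingExpect (zdGraph d) Λ β (-h) .free (fun σ => spinAt p σ * spinAt q σ) := by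
      by_cases hpq : p = q
      · subst hpq
        simp only [spinAt_mul_self, isingExpect_const]
      · have hsub : ({p, q} : Finset (Site d)) ⊆ Λ := by
          intro z hz
          rcases mem_insert.1 hz with rfl | hz
          · exact hp
          · rw [mem_singleton.1 hz]; exact hq
        have hc := isingCorr_flip_of_subset (zdGraph d) Λ β (-h) .free hsub
        rw [neg_neg, BoundaryCondition.flip_free, card_pair hpq] at hc
        have hsp : spinProduct ({p, q} : Finset (Site d)) = fun σ => spinAt p σ * spinAt q σ := by
          funext σ; rw [spinProduct, prod_pair hpq]
        simp only [isingCorr, hsp] at hc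
        rw [hc]; norm_num
    have hflip1 : ∀ z ∈ Λ, isingExpect (zdGraph d) Λ β h .free (spinAt z) =
        -isingExpect (zdGraph d) Λ β (-h) .free (spinAt z) := by
      intro z hz
      have hc := isingCorr_flip_of_subset (zdGraph d) Λ β (-h) .free (singleton_subset_iff.2 hz)
      rw [neg_neg, BoundaryCondition.flip_free, card_singleton] at hc
      simp only [isingCorr, spinProduct_singleton] at hc
      rw [hc]; norm_num
    rw [hflip2, hflip1 p hp, hflip1 q hq, neg_mul_neg]
    exact hpos (-h) (by linarith)

/-- **Exponential decay of the finite-volume truncated pair functions below `β_c`, uniformly in the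
volume and in the field**: for `d ≥ 2` and `0 ≤ β < β_c(d)` there is `c > 0` with
`⟨σ_pσ_q⟩^∅_{Λ;β,h} - ⟨σ_p⟩⟨σ_q⟩ ≤ exp(-c ‖q - p‖)` for all finite `Λ ∋ p, q` and all real `h`
(GHS + Griffiths' volume monotonicity + translation invariance of the free state +
Aizenman–Barsky–Fernández sharpness, `twoPoint_exponentialDecay_of_lt_criticalBeta_holds`; this is
Lebowitz's (2.6) obtained from Lemma 2 (3.1) and the infinite-volume bound (3.3), with [ABF87]
supplying (3.3) for all `β < β_c`). [cite: Lebowitz1972, §II eq. (2.6) and §III Lemma 2, eqs. (3.1), (3.3)] [cite: JiangNewman2023, Remark 4 and Thm. 2] -/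
theorem exists_isingTrunc_le_exp (hd : 2 ≤ d) {β : ℝ} (hβ : 0 ≤ β) (hβc : β < criticalBeta d) :
    ∃ c : ℝ, 0 < c ∧ ∀ (Λ : Finset (Site d)) (h : ℝ) (p q : Site d), p ∈ Λ → q ∈ Λ →
      isingExpect (zdGraph d) Λ β h .free (fun σ => spinAt p σ * spinAt q σ) -
          isingExpect (zdGraph d) Λ β h .free (spinAt p) * isingExpect (zdGraph d) Λ β h .free (spinAt q) ≤
        Real.exp (-c * ‖q - p‖) := by
  obtain ⟨c, hc, hdec⟩ := twoPoint_exponentialDecay_of_lt_criticalBeta_holds (d := d) hd hβ hβc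
  refine ⟨c, hc, fun Λ h p q hp hq => ?_⟩
  refine (isingTrunc_le_zero_field hβ Λ h hp hq).trans ?_
  have h2 := isingTwoPoint_free_le_twoPointFree_sub isingCorr_free_mono_volume_holds
    hasBoxLimit_isingCorr_free_holds isingTwoPoint_free_translate_holds hβ hp hq
  exact h2.trans (hdec (q - p))

end PairCovariance


/-! ### Geometry of `n` points of `ℤ^d`: a bipartition with a gap of order `diam / n` -/

section Geometry

variable {d : ℕ}

/-- A coordinate difference is bounded by the sup-norm distance. [folklore] -/
theorem natAbs_sub_apply_le_supNorm (x y : Site d) (l : Fin d) :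
    ((x l - y l).natAbs : ℕ) ≤ Site.supNorm (x - y) := by
  have := Site.natAbs_le_supNorm (x - y) l
  simpa using this

/-- **Pigeonhole splitting.** For `n ≥ 2` points `x_0, …, x_{n-1}` of `ℤ^d` with
`R = max_i ‖x_i - x_0‖_∞`, there is a bipartition `A ⊔ Aᶜ` of the indices into two nonempty
parts which are `⌊R/n⌋`-separated: `‖x_j - x_i‖_∞ ≥ ⌊R/n⌋` for `i ∈ A`, `j ∉ A` (project on a
coordinate achieving `R`; of the `n` consecutive windows of length `⌊R/n⌋` above `x_0` one contains
no point). [folklore] -/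
theorem exists_separated_bipartition {n : ℕ} (hn : 2 ≤ n) (x : Fin n → Site d) :
    ∃ A : Finset (Fin n), A.Nonempty ∧ (univ \ A).Nonempty ∧
      ∀ i ∈ A, ∀ j ∈ univ \ A,
        (univ.sup fun i => Site.supNorm (x i - x ⟨0, by omega⟩)) / n ≤ Site.supNorm (x j - x i) := by
  set i0 : Fin n := ⟨0, by omega⟩ with hi0
  set R : ℕ := univ.sup fun i => Site.supNorm (x i - x i0) with hR
  set s : ℕ := R / n with hs
  have huniv : (univ : Finset (Fin n)).Nonempty := ⟨i0, mem_univ _⟩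
  -- trivial case `s = 0`
  rcases Nat.eq_zero_or_pos s with hs0 | hspos
  · refine ⟨{i0}, singleton_nonempty _, ⟨⟨1, by omega⟩, ?_⟩, fun i _ j _ => ?_⟩
    · rw [Finset.mem_sdiff, mem_singleton]
      exact ⟨mem_univ _, fun h => by rw [Fin.ext_iff] at h; simp [hi0] at h⟩
    · rw [hs0]; exact Nat.zero_le _
  -- `R` is attained at some index `j⋆` and coordinate `l`
  obtain ⟨jstar, -, hjstar⟩ := exists_mem_eq_sup univ huniv fun i => Site.supNorm (x i - x i0)
  have hRpos : 0 < R := by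
    have : s * n ≤ R := by rw [hs]; exact Nat.div_mul_le_self R n
    have h1 : 1 * 1 ≤ s * n := Nat.mul_le_mul hspos (by omega)
    omega
  have hdpos : (univ : Finset (Fin d)).Nonempty := by
    rw [univ_nonempty_iff]
    by_contra hd
    rw [not_nonempty_iff] at hd
    have : Site.supNorm (x jstar - x i0) = 0 := by
      rw [Site.supNorm]; exact sup_eq_bot_of_isEmpty _ _ |>.trans rfl
    omega
  obtain ⟨l, -, hl⟩ := exists_mem_eq_sup univ hdpos fun b => ((x jstar - x i0) b).natAbs
  have hRl : ((x jstar l - x i0 l).natAbs : ℕ) = R := by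
    rw [hR, hjstar, Site.supNorm, hl]; rfl
  -- orient the coordinate so that `w jstar - w i0 = R`
  obtain ⟨e, he, hew⟩ : ∃ e : ℤ, (e = 1 ∨ e = -1) ∧ e * (x jstar l - x i0 l) = R := by
    rcases Int.natAbs_eq (x jstar l - x i0 l) with h | h
    · refine ⟨1, Or.inl rfl, ?_⟩
      rw [one_mul, h, hRl]
    · refine ⟨-1, Or.inr rfl, ?_⟩
      rw [h, hRl]; ring
  set w : Fin n → ℤ := fun i => e * x i l with hw
  have hwdist : ∀ i j, ((w j - w i).natAbs : ℕ) ≤ Site.supNorm (x j - x i) := by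
    intro i j
    have h1 : w j - w i = e * (x j l - x i l) := by simp only [hw]; ring
    have h2 : (w j - w i).natAbs = (x j l - x i l).natAbs := by
      rw [h1, Int.natAbs_mul]
      rcases he with rfl | rfl <;> simp
    rw [h2]
    exact natAbs_sub_apply_le_supNorm (x j) (x i) l
  have hwstar : w jstar = w i0 + R := by
    have : w jstar - w i0 = R := by simp only [hw]; rw [← hew]; ring
    linarith
  -- the windows `W_k = {i | w i0 + k s < w i ≤ w i0 + (k+1) s}`, `k < n`; one of them is empty
  have hempty : ∃ k : Fin n, ∀ i, ¬ (w i0 + k * s < w i ∧ w i ≤ w i0 + (k + 1) * s) := by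
    by_contra hne
    push Not at hne
    choose g hg using hne
    have hinj : Function.Injective g := by
      intro k k' hkk'
      have h1 := hg k
      have h2 := hg k'
      rw [hkk'] at h1
      have hspos' : (0 : ℤ) < s := by exact_mod_cast hspos
      have hk1 : (k : ℤ) < k' + 1 := by
        by_contra hc
        push Not at hc
        have : ((k' : ℤ) + 1) * s ≤ k * s := mul_le_mul_of_nonneg_right hc hspos'.le
        linarith [h1.1, h2.2]
      have hk2 : (k' : ℤ) < k + 1 := by
        by_contra hc
        push Not at hc
        have : ((k : ℤ) + 1) * s ≤ k' * s := mul_le_mul_of_nonneg_right hc hspos'.le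
        linarith [h1.2, h2.1]
      exact Fin.ext (by omega)
    obtain ⟨k, hk⟩ := (Finite.injective_iff_surjective.1 hinj) i0
    have h := (hg k).1
    rw [hk] at h
    have : (0 : ℤ) ≤ k * s := mul_nonneg (by exact_mod_cast Nat.zero_le _) (by exact_mod_cast Nat.zero_le _)
    linarith
  obtain ⟨k, hk⟩ := hempty
  refine ⟨univ.filter fun i => w i ≤ w i0 + k * s, ⟨i0, ?_⟩, ⟨jstar, ?_⟩, fun i hi j hj => ?_⟩
  · rw [mem_filter]
    refine ⟨mem_univ _, ?_⟩
    have : (0 : ℤ) ≤ k * s := mul_nonneg (by exact_mod_cast Nat.zero_le _) (by exact_mod_cast Nat.zero_le _)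
    linarith
  · rw [Finset.mem_sdiff, mem_filter]
    refine ⟨mem_univ _, fun ⟨_, hle⟩ => ?_⟩
    have hkn : (k : ℤ) + 1 ≤ n := by exact_mod_cast k.2
    have hsn : (n : ℤ) * s ≤ R := by exact_mod_cast (by rw [hs, mul_comm]; exact Nat.div_mul_le_self R n)
    have hspos' : (0 : ℤ) < s := by exact_mod_cast hspos
    have : ((k : ℤ) + 1) * s ≤ n * s := mul_le_mul_of_nonneg_right hkn hspos'.le
    nlinarith
  · rw [mem_filter] at hi
    rw [Finset.mem_sdiff, mem_filter] at hj
    have hj' : ¬ w j ≤ w i0 + k * s := fun h => hj.2 ⟨mem_univ _, h⟩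
    push Not at hj'
    have hjk := hk j
    have hj2 : w i0 + (k + 1) * s < w j := by
      by_contra hc
      push Not at hc
      exact hjk ⟨hj', hc⟩
    have hgap : (s : ℤ) ≤ w j - w i := by nlinarith [hi.2]
    have h1 : s ≤ (w j - w i).natAbs := by
      have := Int.le_natAbs (a := w j - w i)
      omega
    exact (show R / n = s from rfl) ▸ h1.trans (hwdist i j)

end Geometry

/-! ### Lattice sums of `exp(-c ‖y - p‖)` are bounded uniformly in the volume -/

section LatticeSums

variable {d : ℕ}

/-- `∑_m (2m+1)^d q^m < ∞` for `0 ≤ q < 1`. [folklore] -/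
theorem summable_card_box_mul_pow {q : ℝ} (hq0 : 0 ≤ q) (hq1 : q < 1) :
    Summable fun m : ℕ => ((2 * m + 1 : ℕ) : ℝ) ^ d * q ^ m := by
  have hqn : ‖q‖ < 1 := by rwa [Real.norm_eq_abs, abs_of_nonneg hq0]
  have hs : Summable fun m : ℕ => (3 : ℝ) ^ d * ((m : ℝ) ^ d * q ^ m) + q ^ m :=
    ((summable_pow_mul_geometric_of_norm_lt_one d hqn).mul_left _).add
      (summable_geometric_of_lt_one hq0 hq1)
  refine Summable.of_nonneg_of_le (fun m => by positivity) (fun m => ?_) hs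
  have hle : ((2 * m + 1 : ℕ) : ℝ) ^ d ≤ 3 ^ d * (m : ℝ) ^ d + 1 := by
    rcases Nat.eq_zero_or_pos m with rfl | hm
    · simp
    · have h3 : ((2 * m + 1 : ℕ) : ℝ) ≤ 3 * m := by
        have : (1 : ℝ) ≤ m := by exact_mod_cast hm
        push_cast; linarith
      calc ((2 * m + 1 : ℕ) : ℝ) ^ d ≤ (3 * m : ℝ) ^ d := by gcongr
        _ = 3 ^ d * (m : ℝ) ^ d := by rw [mul_pow]
        _ ≤ 3 ^ d * (m : ℝ) ^ d + 1 := by linarith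
  calc ((2 * m + 1 : ℕ) : ℝ) ^ d * q ^ m ≤ (3 ^ d * (m : ℝ) ^ d + 1) * q ^ m :=
        mul_le_mul_of_nonneg_right hle (pow_nonneg hq0 m)
    _ = 3 ^ d * ((m : ℝ) ^ d * q ^ m) + q ^ m := by ring

/-- **Uniform bound on lattice sums of an exponential**: for `c > 0`,
`∑_{y ∈ Λ} exp(-c ‖y - p‖_∞) ≤ K(c, d) := ∑_m (2m+1)^d e^{-cm}` for every finite `Λ ⊂ ℤ^d` and
every `p`. [folklore] -/
theorem sum_exp_neg_mul_norm_sub_le {c : ℝ} (hc : 0 < c) (Λ : Finset (Site d)) (p : Site d) :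
    ∑ y ∈ Λ, Real.exp (-c * ‖y - p‖) ≤
      ∑' m : ℕ, ((2 * m + 1 : ℕ) : ℝ) ^ d * Real.exp (-c) ^ m := by
  set q : ℝ := Real.exp (-c) with hq
  have hq0 : 0 ≤ q := (Real.exp_pos _).le
  have hq1 : q < 1 := Real.exp_lt_one_iff.2 (by linarith)
  have hsum := summable_card_box_mul_pow (d := d) hq0 hq1
  have hexp : ∀ z : Site d, Real.exp (-c * ‖z‖) = q ^ Site.supNorm z := fun z => by
    rw [Site.norm_eq_supNorm, hq, ← Real.exp_nat_mul]; ring_nf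
  -- translate to `p = 0`
  have htr : ∑ y ∈ Λ, Real.exp (-c * ‖y - p‖) = ∑ z ∈ Λ.image (· - p), q ^ Site.supNorm z := by
    rw [sum_image fun a _ b _ (h : a - p = b - p) => sub_left_injective h]
    exact sum_congr rfl fun y _ => hexp (y - p)
  rw [htr]
  set Λ' := Λ.image (· - p) with hΛ'
  set N : ℕ := Λ'.sup Site.supNorm with hN
  have hsub : Λ' ⊆ box d N := fun z hz => mem_box_iff_supNorm_le.2 (le_sup hz)
  calc ∑ z ∈ Λ', q ^ Site.supNorm z ≤ ∑ z ∈ box d N, q ^ Site.supNorm z :=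
        sum_le_sum_of_subset_of_nonneg hsub fun z _ _ => pow_nonneg hq0 _
    _ = ∑ m ∈ range (N + 1), ∑ z ∈ (box d N).filter (fun z => Site.supNorm z = m), q ^ Site.supNorm z := by
        rw [sum_fiberwise_of_maps_to]
        intro z hz
        rw [mem_range, Nat.lt_succ_iff]
        exact mem_box_iff_supNorm_le.1 hz
    _ = ∑ m ∈ range (N + 1), (((box d N).filter (fun z => Site.supNorm z = m)).card : ℝ) * q ^ m := by
        refine sum_congr rfl fun m _ => ?_
        have : ∀ z ∈ (box d N).filter (fun z => Site.supNorm z = m), q ^ Site.supNorm z = q ^ m :=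
          fun z hz => by rw [(mem_filter.1 hz).2]
        rw [sum_congr rfl this, sum_const, nsmul_eq_mul]
    _ ≤ ∑ m ∈ range (N + 1), ((2 * m + 1 : ℕ) : ℝ) ^ d * q ^ m := by
        refine sum_le_sum fun m _ => mul_le_mul_of_nonneg_right ?_ (pow_nonneg hq0 _)
        have hcard : ((box d N).filter (fun z => Site.supNorm z = m)).card ≤ (box d m).card :=
          card_le_card fun z hz => mem_box_iff_supNorm_le.2 (mem_filter.1 hz).2.le
        rw [card_box] at hcard
        exact_mod_cast hcard
    _ ≤ ∑' m : ℕ, ((2 * m + 1 : ℕ) : ℝ) ^ d * q ^ m :=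
        hsum.sum_le_tsum _ fun m _ => by positivity

end LatticeSums


/-! ### Decay and summability of the finite-volume Ursell functions below `β_c` -/

section UrsellDecay

variable {d : ℕ}

/-- The Lipschitz constant of the Möbius polynomial on `n` variables-sets:
`L_n = ∑_{π ∈ setPartitions [n]} (|π|-1)! |π|` (a harmless explicit constant). [folklore] -/
theorem partitionConst_nonneg (n : ℕ) :
    0 ≤ ∑ π ∈ setPartitions (univ : Finset (Fin n)), (((π.card - 1).factorial : ℝ) * π.card) :=
  sum_nonneg fun π _ => by positivity

/-- **Clustering of the finite-volume Ursell functions** (the heart of [Leb72] as used in JN Thm. 2):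
in the free-boundary Ising model on `Λ ⊂ ℤ^d` at `β ≥ 0` and any field, if the truncated pair
functions are dominated by `G(q - p)`, then for `n` sites `x_0, …, x_{n-1} ∈ Λ` and every
bipartition `A ⊔ Aᶜ` of the indices into nonempty parts,
`|u_n(σ_{x_0}, …, σ_{x_{n-1}})| ≤ L_n ∑_{i ∈ A, j ∉ A} G(x_j - x_i)`
(Lebowitz's FKG covariance bound fed into the cluster bound `abs_ursellOf_le_of_almost_factorises`;
Lebowitz's (1.12): `|U_ℓ(i_1,…,i_ℓ)| ≤ C_ℓ ū(d(A,B))`). [cite: Lebowitz1972, §I eqs. (1.9), (1.12)] -/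
theorem abs_ursell_le_partitionConst_mul_sum {β : ℝ} (hβ : 0 ≤ β) (Λ : Finset (Site d)) (h : ℝ)
    {G : Site d → ℝ}
    (hG : ∀ p q : Site d, p ∈ Λ → q ∈ Λ →
      isingExpect (zdGraph d) Λ β h .free (fun σ => spinAt p σ * spinAt q σ) -
          isingExpect (zdGraph d) Λ β h .free (spinAt p) * isingExpect (zdGraph d) Λ β h .free (spinAt q) ≤
        G (q - p))
    {n : ℕ} (x : Fin n → Site d) (hx : ∀ i, x i ∈ Λ) (A : Finset (Fin n)) (hA : A.Nonempty)
    (hAc : (univ \ A).Nonempty) :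
    |ursellOf (fun S : Finset (Fin n) =>
        isingExpect (zdGraph d) Λ β h .free (fun σ => ∏ i ∈ S, spinAt (x i) σ)) univ| ≤
      (∑ π ∈ setPartitions (univ : Finset (Fin n)), (((π.card - 1).factorial : ℝ) * π.card)) *
        ∑ i ∈ A, ∑ j ∈ univ \ A, G (x j - x i) := by
  set E := isingExpect (zdGraph d) Λ β h .free with hE
  set m : Finset (Fin n) → ℝ := fun S => E (fun σ => ∏ i ∈ S, spinAt (x i) σ) with hm
  have hm0 : m ∅ = 1 := by simp [hm, hE, isingExpect_const]
  have hm1 : ∀ S, |m S| ≤ 1 := fun S =>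
    abs_isingExpect_le_one_of_countable (zdGraph d) Λ β h .free (abs_prod_spinAt_le_one S x)
  refine abs_ursellOf_le_of_almost_factorises m hm0 hm1 A hA hAc fun S => ?_
  -- Lebowitz's bound for the pair `S ∩ A ⊆ A`, `S \ A ⊆ univ \ A`
  have hsplit : m S = E (fun σ => (∏ i ∈ S ∩ A, spinAt (x i) σ) * ∏ i ∈ S \ A, spinAt (x i) σ) := by
    simp only [hm]
    congr 1
    funext σ
    rw [prod_inter_mul_prod_sdiff]
  have hleb := abs_cov_prod_le_cov_sum (zdGraph d) hβ Λ h .free x A (inter_subset_right (s₁ := S))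
    (sdiff_subset_sdiff (subset_univ S) (Subset.refl A))
  rw [← hE, ← hsplit] at hleb
  refine hleb.trans ?_
  rw [cov_sum_sum_eq (zdGraph d) Λ β h .free x A (univ \ A)]
  exact sum_le_sum fun i _ => sum_le_sum fun j _ => hG (x i) (x j) (hx i) (hx j)

/-- **Pointwise exponential decay of the Ursell functions in the diameter** (uniformly in the
volume and the field): with `G(z) = exp(-c‖z‖)` in `abs_ursell_le_partitionConst_mul_sum` and the
pigeonhole bipartition, for `n ≥ 2`,
`|u_n(σ_{x_0}, …, σ_{x_{n-1}})| ≤ L_n n² e^{c} ∏_i exp(-(c/n²) ‖x_i - x_0‖)` (Lebowitz's (1.13):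
`|U_ℓ| ≤ C_ℓ ū(R_ℓ/(ℓ-1))`, `R_ℓ` the diameter; here with the cruder gap `⌊R/ℓ⌋`).
[cite: Lebowitz1972, §I eq. (1.13)] -/
theorem abs_ursell_le_prod_exp {β : ℝ} (hβ : 0 ≤ β) (Λ : Finset (Site d)) (h : ℝ) {c : ℝ} (hc : 0 < c)
    (hG : ∀ p q : Site d, p ∈ Λ → q ∈ Λ →
      isingExpect (zdGraph d) Λ β h .free (fun σ => spinAt p σ * spinAt q σ) -
          isingExpect (zdGraph d) Λ β h .free (spinAt p) * isingExpect (zdGraph d) Λ β h .free (spinAt q) ≤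
        Real.exp (-c * ‖q - p‖))
    {n : ℕ} (hn : 2 ≤ n) (x : Fin n → Site d) (hx : ∀ i, x i ∈ Λ) :
    |ursellOf (fun S : Finset (Fin n) =>
        isingExpect (zdGraph d) Λ β h .free (fun σ => ∏ i ∈ S, spinAt (x i) σ)) univ| ≤
      (∑ π ∈ setPartitions (univ : Finset (Fin n)), (((π.card - 1).factorial : ℝ) * π.card)) *
        ((n : ℝ) ^ 2 * Real.exp c * ∏ i, Real.exp (-(c / n ^ 2) * ‖x i - x ⟨0, by omega⟩‖)) := by
  set i0 : Fin n := ⟨0, by omega⟩ with hi0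
  set L := ∑ π ∈ setPartitions (univ : Finset (Fin n)), (((π.card - 1).factorial : ℝ) * π.card)
    with hL
  have hL0 : 0 ≤ L := partitionConst_nonneg n
  obtain ⟨A, hA, hAc, hsep⟩ := exists_separated_bipartition hn x
  set R : ℕ := univ.sup fun i => Site.supNorm (x i - x i0) with hR
  set s : ℕ := R / n with hs
  have h1 := abs_ursell_le_partitionConst_mul_sum hβ Λ h (G := fun z => Real.exp (-c * ‖z‖)) hG x hx
    A hA hAc
  refine h1.trans (mul_le_mul_of_nonneg_left ?_ hL0)
  -- each of the `≤ n²` terms is `≤ exp(-c s)`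
  have hterm : ∀ i ∈ A, ∀ j ∈ univ \ A, Real.exp (-c * ‖x j - x i‖) ≤ Real.exp (-c * s) := by
    intro i hi j hj
    rw [Real.exp_le_exp, Site.norm_eq_supNorm]
    have : (s : ℝ) ≤ (Site.supNorm (x j - x i) : ℝ) := by exact_mod_cast hsep i hi j hj
    nlinarith
  have hsum : ∑ i ∈ A, ∑ j ∈ univ \ A, Real.exp (-c * ‖x j - x i‖) ≤ (n : ℝ) ^ 2 * Real.exp (-c * s) := by
    calc ∑ i ∈ A, ∑ j ∈ univ \ A, Real.exp (-c * ‖x j - x i‖)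
        ≤ ∑ i ∈ A, ∑ j ∈ univ \ A, Real.exp (-c * s) :=
          sum_le_sum fun i hi => sum_le_sum fun j hj => hterm i hi j hj
      _ = (A.card : ℝ) * ((univ \ A).card * Real.exp (-c * s)) := by
          rw [sum_const, sum_const, nsmul_eq_mul, nsmul_eq_mul]
      _ ≤ (n : ℝ) * ((n : ℝ) * Real.exp (-c * s)) := by
          have hA' : (A.card : ℝ) ≤ n := by exact_mod_cast (card_le_univ A).trans_eq (Fintype.card_fin n)
          have hAc' : ((univ \ A).card : ℝ) ≤ n := by
            exact_mod_cast (card_le_univ (univ \ A)).trans_eq (Fintype.card_fin n)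
          have he : 0 ≤ Real.exp (-c * s) := (Real.exp_pos _).le
          exact mul_le_mul hA' (mul_le_mul_of_nonneg_right hAc' he) (by positivity) (by positivity)
      _ = (n : ℝ) ^ 2 * Real.exp (-c * s) := by ring
  refine hsum.trans ?_
  rw [mul_assoc]
  refine mul_le_mul_of_nonneg_left ?_ (by positivity)
  -- `exp(-c s) ≤ e^c ∏_i exp(-(c/n²) ‖x_i - x_0‖)` since `∑_i ‖x_i - x_0‖ ≤ n R ≤ n² (s + 1)`
  rw [← Real.exp_sum, ← Real.exp_add, Real.exp_le_exp]
  have hnpos : (0 : ℝ) < n := by exact_mod_cast (show 0 < n by omega)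
  have hRi : ∀ i, (Site.supNorm (x i - x i0) : ℝ) ≤ R := fun i => by
    exact_mod_cast (le_sup (f := fun i => Site.supNorm (x i - x i0)) (mem_univ i))
  have hsumR : ∑ i, ‖x i - x i0‖ ≤ n * R := by
    calc ∑ i, ‖x i - x i0‖ ≤ ∑ _i : Fin n, (R : ℝ) :=
          sum_le_sum fun i _ => by rw [Site.norm_eq_supNorm]; exact hRi i
      _ = n * R := by rw [sum_const, nsmul_eq_mul, card_univ, Fintype.card_fin]
  have hRs : (R : ℝ) < n * (s + 1) := by
    have : R < n * (s + 1) := by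
      rw [hs]
      have := Nat.lt_div_mul_add (a := R) (b := n) (show 0 < n by omega)
      nlinarith [Nat.div_mul_le_self R n, this]
    exact_mod_cast this
  have hkey : (c / n ^ 2) * ∑ i, ‖x i - x i0‖ ≤ c * (s + 1) := by
    calc (c / n ^ 2) * ∑ i, ‖x i - x i0‖ ≤ (c / n ^ 2) * (n * R) :=
          mul_le_mul_of_nonneg_left hsumR (by positivity)
      _ ≤ (c / n ^ 2) * (n * (n * (s + 1))) := by
          refine mul_le_mul_of_nonneg_left ?_ (by positivity)
          exact mul_le_mul_of_nonneg_left hRs.le hnpos.le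
      _ = c * (s + 1) := by field_simp
  have : ∑ i, -(c / n ^ 2) * ‖x i - x i0‖ = -((c / n ^ 2) * ∑ i, ‖x i - x i0‖) := by
    rw [mul_sum, ← sum_neg_distrib]
    exact sum_congr rfl fun i _ => by ring
  rw [this]
  linarith

/-- Sums over `[n+1] → Λ` of products rooted at the coordinate `0` factorise. [folklore] -/
theorem sum_pi_prod_root_eq {k : ℕ} (Λ : Finset (Site d)) (g : Site d → Site d → ℝ) :
    ∑ x : Fin (k + 1) → Λ, ∏ i, g (x i) (x 0) =
      ∑ p : Λ, g p p * (∑ y : Λ, g y p) ^ k := by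
  rw [← (Fin.consEquiv fun _ : Fin (k + 1) => ↥Λ).sum_comp
    (fun x : Fin (k + 1) → ↥Λ => ∏ i, g (x i) (x 0)), Fintype.sum_prod_type]
  refine sum_congr rfl fun p _ => ?_
  simp only [Fin.consEquiv_apply, Fin.prod_univ_succ, Fin.cons_zero, Fin.cons_succ]
  rw [← mul_sum, ← Fintype.prod_sum (fun (_ : Fin k) (y : Λ) => g y p)]
  rw [prod_const, card_univ, Fintype.card_fin]

/-- **Summability of the Ursell functions, uniformly in the volume and the field** (JN Thm. 2 /
[Leb72]: "`f_β` is infinitely differentiable … whenever the truncated two-point functions decay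
exponentially; the latter is proved in [ABF87]"): for `d ≥ 2`, `0 ≤ β < β_c(d)` and `k ≥ 1` there is
`C` with `∑_{x : [k+1] → Λ} |u_{k+1}(σ_{x_0}, …, σ_{x_k})| ≤ C |Λ|` for every finite `Λ` and every
real field (Lebowitz's (2.7): `|Λ|^{-1}|∑ U_{m+1}| ≤ D_m ∑_r ū(r) r^{mν-1} < ∞` under (2.6)).
[cite: Lebowitz1972, §II eqs. (2.4), (2.6)–(2.7)] [cite: JiangNewman2023, Thm. 2] -/
theorem exists_sum_abs_ursell_le (hd : 2 ≤ d) {β : ℝ} (hβ : 0 ≤ β) (hβc : β < criticalBeta d)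
    {k : ℕ} (hk : 1 ≤ k) :
    ∃ C : ℝ, ∀ (Λ : Finset (Site d)) (h : ℝ),
      ∑ x : Fin (k + 1) → Λ, |ursellOf (fun S : Finset (Fin (k + 1)) =>
        isingExpect (zdGraph d) Λ β h .free (fun σ => ∏ i ∈ S, spinAt ((x i : Site d)) σ)) univ| ≤
      C * Λ.card := by
  obtain ⟨c, hc, hdec⟩ := exists_isingTrunc_le_exp hd hβ hβc
  set n : ℕ := k + 1 with hn
  have hn2 : 2 ≤ n := by omega
  set L := ∑ π ∈ setPartitions (univ : Finset (Fin n)), (((π.card - 1).factorial : ℝ) * π.card)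
    with hL
  set c' : ℝ := c / n ^ 2 with hc'
  have hc'pos : 0 < c' := by positivity
  set K : ℝ := ∑' m : ℕ, ((2 * m + 1 : ℕ) : ℝ) ^ d * Real.exp (-c') ^ m with hK
  have hK0 : 0 ≤ K := tsum_nonneg fun m => by positivity
  refine ⟨L * ((n : ℝ) ^ 2 * Real.exp c) * K ^ k, fun Λ h => ?_⟩
  have hpt : ∀ x : Fin n → Λ,
      |ursellOf (fun S : Finset (Fin n) =>
        isingExpect (zdGraph d) Λ β h .free (fun σ => ∏ i ∈ S, spinAt ((x i : Site d)) σ)) univ| ≤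
      L * ((n : ℝ) ^ 2 * Real.exp c * ∏ i, Real.exp (-c' * ‖(x i : Site d) - (x ⟨0, by omega⟩ : Site d)‖)) :=
    fun x => abs_ursell_le_prod_exp hβ Λ h hc (hdec Λ h) hn2 (fun i => (x i : Site d)) fun i => (x i).2
  calc ∑ x : Fin (k + 1) → Λ, |ursellOf (fun S : Finset (Fin (k + 1)) =>
          isingExpect (zdGraph d) Λ β h .free (fun σ => ∏ i ∈ S, spinAt ((x i : Site d)) σ)) univ|
      ≤ ∑ x : Fin (k + 1) → Λ, L * ((n : ℝ) ^ 2 * Real.exp c *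
          ∏ i, Real.exp (-c' * ‖(x i : Site d) - (x 0 : Site d)‖)) := sum_le_sum fun x _ => hpt x
    _ = L * ((n : ℝ) ^ 2 * Real.exp c) *
          ∑ x : Fin (k + 1) → Λ, ∏ i, Real.exp (-c' * ‖(x i : Site d) - (x 0 : Site d)‖) := by
        rw [mul_sum]; exact sum_congr rfl fun x _ => by ring
    _ = L * ((n : ℝ) ^ 2 * Real.exp c) *
          ∑ p : Λ, Real.exp (-c' * ‖(p : Site d) - p‖) *
            (∑ y : Λ, Real.exp (-c' * ‖(y : Site d) - p‖)) ^ k := by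
        rw [sum_pi_prod_root_eq Λ (fun a b => Real.exp (-c' * ‖a - b‖))]
    _ ≤ L * ((n : ℝ) ^ 2 * Real.exp c) * ∑ _p : Λ, K ^ k := by
        refine mul_le_mul_of_nonneg_left (sum_le_sum fun p _ => ?_)
          (mul_nonneg (partitionConst_nonneg n) (by positivity))
        rw [sub_self, norm_zero, mul_zero, Real.exp_zero, one_mul]
        refine pow_le_pow_left₀ (sum_nonneg fun y _ => (Real.exp_pos _).le) ?_ k
        have := sum_exp_neg_mul_norm_sub_le hc'pos Λ (p : Site d)
        rwa [← Finset.sum_coe_sort Λ] at this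
    _ = L * ((n : ℝ) ^ 2 * Real.exp c) * K ^ k * Λ.card := by
        rw [sum_const, nsmul_eq_mul, card_univ, Fintype.card_coe]; ring

/-- The case of one point: `∑_{x ∈ Λ} |u_1(σ_x)| ≤ |Λ|`. [folklore] -/
theorem sum_abs_ursell_one_le (Λ : Finset (Site d)) (β h : ℝ) :
    ∑ x : Fin 1 → Λ, |ursellOf (fun S : Finset (Fin 1) =>
        isingExpect (zdGraph d) Λ β h .free (fun σ => ∏ i ∈ S, spinAt ((x i : Site d)) σ)) univ| ≤
      Λ.card := by
  have huniv : (univ : Finset (Fin 1)) = {0} := by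
    ext i
    simp only [mem_univ, mem_singleton, true_iff]
    exact Subsingleton.elim i 0
  calc ∑ x : Fin 1 → Λ, |ursellOf (fun S : Finset (Fin 1) =>
          isingExpect (zdGraph d) Λ β h .free (fun σ => ∏ i ∈ S, spinAt ((x i : Site d)) σ)) univ|
      ≤ ∑ _x : Fin 1 → Λ, (1 : ℝ) := by
        refine sum_le_sum fun x _ => ?_
        rw [huniv, ursellOf_singleton]
        exact abs_isingExpect_le_one_of_countable (zdGraph d) Λ β h .free
          (abs_prod_spinAt_le_one _ (fun i => (x i : Site d)))
    _ = Λ.card := by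
        rw [sum_const, nsmul_eq_mul, mul_one, card_univ, Fintype.card_fun, Fintype.card_fin, pow_one,
          Fintype.card_coe]

/-- **Uniform bound on the cumulants of the magnetisation**: for `d ≥ 2`, `0 ≤ β < β_c(d)` and
`n ≥ 1` there is `C_n` with `|κ_n(M_Λ)| ≤ C_n |Λ|` under `⟨·⟩^∅_{Λ;β,h}`, for every finite `Λ` and
every real field `h` (cumulant of the total magnetisation = sum of the Ursell functions of the
spins, `cumulantOf_pow_sum_eq`; Lebowitz's (2.4b) with (2.7)). [cite: Lebowitz1972, §II eqs. (2.4), (2.7)] [cite: JiangNewman2023, Thm. 2] -/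
theorem exists_abs_cumulantOf_magnetization_le (hd : 2 ≤ d) {β : ℝ} (hβ : 0 ≤ β)
    (hβc : β < criticalBeta d) {n : ℕ} (hn : 1 ≤ n) :
    ∃ C : ℝ, ∀ (Λ : Finset (Site d)) (h : ℝ),
      |cumulantOf (fun m => isingExpect (zdGraph d) Λ β h .free
        (fun σ => (∑ x ∈ Λ, spinAt x σ) ^ m)) n| ≤ C * Λ.card := by
  obtain ⟨k, rfl⟩ : ∃ k, n = k + 1 := ⟨n - 1, by omega⟩
  -- the expansion into Ursell functions
  have hexp : ∀ (Λ : Finset (Site d)) (h : ℝ),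
      cumulantOf (fun m => isingExpect (zdGraph d) Λ β h .free (fun σ => (∑ x ∈ Λ, spinAt x σ) ^ m))
        (k + 1) =
      ∑ x : Fin (k + 1) → Λ, (∏ i, (fun _ : Λ => (1 : ℝ)) (x i)) *
        ursellOf (fun S : Finset (Fin (k + 1)) =>
          isingExpect (zdGraph d) Λ β h .free (fun σ => ∏ i ∈ S, spinAt ((x i : Site d)) σ)) univ := by
    intro Λ h
    have hM : ∀ σ : SpinConfig (Site d), ∑ x ∈ Λ, spinAt x σ =
        ∑ u : Λ, (fun _ : Λ => (1 : ℝ)) u * spinAt (u : Site d) σ := by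
      intro σ
      rw [← Finset.sum_coe_sort Λ]
      exact sum_congr rfl fun u _ => (one_mul _).symm
    simp_rw [hM]
    exact cumulantOf_pow_sum_eq (isingExpect (zdGraph d) Λ β h .free)
      (isingExpect_add_of_countable (zdGraph d) Λ β h .free)
      (isingExpect_smul_of_countable (zdGraph d) Λ β h .free) (isingExpect_const _ _ _ _ _ _)
      (fun _ : Λ => (1 : ℝ)) (fun (u : Λ) σ => spinAt (u : Site d) σ) (Nat.succ_pos k)
  rcases Nat.eq_zero_or_pos k with rfl | hk
  · refine ⟨1, fun Λ h => ?_⟩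
    rw [hexp, one_mul]
    refine (abs_sum_le_sum_abs _ _).trans ?_
    simp only [prod_const_one, one_mul]
    exact sum_abs_ursell_one_le Λ β h
  · obtain ⟨C, hC⟩ := exists_sum_abs_ursell_le hd hβ hβc hk
    refine ⟨C, fun Λ h => ?_⟩
    rw [hexp]
    refine (abs_sum_le_sum_abs _ _).trans ?_
    simp only [prod_const_one, one_mul]
    exact hC Λ h

end UrsellDecay

/-! ### Field derivatives of `ln Z` are the cumulants of the magnetisation (every real field) -/

section ExpFamily

variable {Ω' : Type*} [Fintype Ω']

/-- `d/dz ∑_ω C_ω e^{z B_ω} = ∑_ω C_ω B_ω e^{z B_ω}`. [folklore] -/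
theorem hasDerivAt_sum_mul_cexp (C B : Ω' → ℂ) (z : ℂ) :
    HasDerivAt (fun z => ∑ ω, C ω * Complex.exp (z * B ω))
      (∑ ω, (C ω * B ω) * Complex.exp (z * B ω)) z := by
  refine HasDerivAt.fun_sum fun ω _ => ?_
  have h1 : HasDerivAt (fun z : ℂ => z * B ω) (B ω) z := by
    simpa using (hasDerivAt_id z).mul_const (B ω)
  exact (h1.cexp.const_mul (C ω)).congr_deriv (by ring)

/-- `(d/dz)ᵐ ∑_ω C_ω e^{z B_ω} = ∑_ω C_ω B_ωᵐ e^{z B_ω}`. [folklore] -/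
theorem iteratedDeriv_sum_mul_cexp (C B : Ω' → ℂ) (m : ℕ) :
    iteratedDeriv m (fun z => ∑ ω, C ω * Complex.exp (z * B ω)) =
      fun z => ∑ ω, (C ω * B ω ^ m) * Complex.exp (z * B ω) := by
  induction m generalizing C with
  | zero => funext z; simp
  | succ m ih =>
    rw [iteratedDeriv_succ']
    have hd : deriv (fun z => ∑ ω, C ω * Complex.exp (z * B ω)) =
        fun z => ∑ ω, (C ω * B ω) * Complex.exp (z * B ω) :=
      funext fun z => (hasDerivAt_sum_mul_cexp C B z).deriv
    rw [hd, ih (fun ω => C ω * B ω)]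
    funext z
    exact sum_congr rfl fun ω _ => by ring

/-- The exponential sum is entire. [folklore] -/
theorem differentiable_sum_mul_cexp (C B : Ω' → ℂ) :
    Differentiable ℂ (fun z => ∑ ω, C ω * Complex.exp (z * B ω)) :=
  fun z => (hasDerivAt_sum_mul_cexp C B z).differentiableAt

/-- **Derivatives of the logarithm of an exponential family are the cumulants of its tilted
moments.** For reals `a_ω`, `M_ω` on a finite nonempty index set and
`Z(s) = ∑_ω exp(a_ω + s M_ω)`, for every `n ≥ 1` and every real `t`,
`(d/ds)ⁿ ln Z |_{s=t} = κ_n`, the `n`-th cumulant of the moment sequence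
`m ↦ ∑_ω M_ωᵐ e^{a_ω + t M_ω} / Z(t)` (JN (2.2)–(2.3): "`u_k(M_{Λ,β,h}) = dᵏ ln Z_{Λ,β,h}/dhᵏ`",
at every `h`; proved through the local complex logarithm of `z ↦ Z(t+z)/Z(t)` and
`iteratedDeriv_succ_eq_cumulantOf`). [cite: JiangNewman2023, §2 eqs. (2.2)–(2.3)] -/
theorem iteratedDeriv_log_sum_exp_eq_cumulantOf [Nonempty Ω'] (a M : Ω' → ℝ) {n : ℕ} (hn : 1 ≤ n)
    (t : ℝ) :
    iteratedDeriv n (fun s : ℝ => Real.log (∑ ω, Real.exp (a ω + s * M ω))) t =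
      cumulantOf (fun m => (∑ ω, M ω ^ m * Real.exp (a ω + t * M ω)) /
        ∑ ω, Real.exp (a ω + t * M ω)) n := by
  set Zr : ℝ → ℝ := fun s => ∑ ω, Real.exp (a ω + s * M ω) with hZr
  have hZpos : ∀ s, 0 < Zr s := fun s => sum_pos (fun ω _ => Real.exp_pos _) univ_nonempty
  set Z0 : ℝ := Zr t with hZ0
  set μ : ℕ → ℝ := fun m => (∑ ω, M ω ^ m * Real.exp (a ω + t * M ω)) / Z0 with hμ
  have hμ0 : μ 0 = 1 := by
    simp only [hμ, pow_zero, one_mul]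
    exact div_self (hZpos t).ne'
  -- the complex moment generating function `f(z) = Z(t+z)/Z(t)` and its local logarithm
  set C : Ω' → ℂ := fun ω => ((Real.exp (a ω + t * M ω) / Z0 : ℝ) : ℂ) with hC
  set f : ℂ → ℂ := fun z => ∑ ω, C ω * Complex.exp (z * (M ω : ℂ)) with hf
  have hfdiff : Differentiable ℂ f := differentiable_sum_mul_cexp C fun ω => (M ω : ℂ)
  have hfreal : ∀ s : ℝ, f (s : ℂ) = ((Zr (t + s) / Z0 : ℝ) : ℂ) := by
    intro s
    simp only [hf, hC, hZr]
    rw [sum_div]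
    push_cast
    refine sum_congr rfl fun ω _ => ?_
    rw [div_mul_eq_mul_div, ← Complex.exp_add]
    congr 2
    ring
  have hf0 : f 0 = 1 := by
    have := hfreal 0
    rw [Complex.ofReal_zero] at this
    rw [this, add_zero, ← hZ0, div_self (hZpos t).ne', Complex.ofReal_one]
  set U : Set ℂ := f ⁻¹' Complex.slitPlane with hU
  have hUo : IsOpen U := Complex.isOpen_slitPlane.preimage hfdiff.continuous
  have h0U : (0 : ℂ) ∈ U := by
    change f 0 ∈ Complex.slitPlane
    rw [hf0]; exact Complex.one_mem_slitPlane
  set L : ℂ → ℂ := fun z => Complex.log (f z) with hL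
  have hLdiff : DifferentiableOn ℂ L U := fun z hz =>
    ((hfdiff z).clog hz).differentiableWithinAt
  have hLan : AnalyticAt ℂ L 0 := hLdiff.analyticAt (hUo.mem_nhds h0U)
  have hfan : AnalyticAt ℂ f 0 := hfdiff.differentiableOn.analyticAt (isOpen_univ.mem_nhds trivial)
  have hfL : ∀ᶠ z in 𝓝 0, f z = Complex.exp (L z) := by
    filter_upwards [hUo.mem_nhds h0U] with z hz
    exact (Complex.exp_log (Complex.slitPlane_ne_zero hz)).symm
  -- the Taylor coefficients of `L` at `0` are the cumulants of the moments
  obtain ⟨k, rfl⟩ : ∃ k, n = k + 1 := ⟨n - 1, by omega⟩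
  have hcum := iteratedDeriv_succ_eq_cumulantOf hfan hLan hfL hf0 k
  have hmom : ∀ m, iteratedDeriv m f 0 = ((μ m : ℝ) : ℂ) := by
    intro m
    rw [hf, iteratedDeriv_sum_mul_cexp]
    simp only [zero_mul, Complex.exp_zero, mul_one, hμ, hC]
    rw [sum_div]
    push_cast
    exact sum_congr rfl fun ω _ => by ring
  simp_rw [hmom] at hcum
  rw [cumulantOf_ofReal μ hμ0 (Nat.succ_pos k)] at hcum
  -- the real trace of `L` is `s ↦ ln Z(t+s) - ln Z(t)`
  have hLreal : ∀ s : ℝ, L (s : ℂ) = ((Real.log (Zr (t + s)) - Real.log Z0 : ℝ) : ℂ) := by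
    intro s
    simp only [hL]
    rw [hfreal s, ← Complex.ofReal_log (div_pos (hZpos _) (hZpos t)).le,
      Real.log_div (hZpos _).ne' (hZpos t).ne']
  obtain ⟨r, hr, hrU⟩ := Metric.isOpen_iff.1 hUo 0 h0U
  have hre := iteratedDeriv_re_ofReal_eq (hLdiff.mono hrU) (k + 1) (t := 0) (by simpa using hr)
  have hfun : (fun s : ℝ => (L s).re) = fun s => Real.log (Zr (t + s)) - Real.log Z0 := by
    funext s; rw [hLreal s, Complex.ofReal_re]
  rw [hfun, Complex.ofReal_zero, hcum, Complex.ofReal_re] at hre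
  rw [← hre]
  -- shift `s ↦ t + s` and drop the constant
  have hshift := congrFun (iteratedDeriv_comp_const_add (k + 1) (fun s => Real.log (Zr s)) t) 0
  rw [add_zero] at hshift
  rw [← hshift]
  have hsub : (fun s => Real.log (Zr (t + s)) - Real.log Z0) =
      fun s => -Real.log Z0 + Real.log (Zr (t + s)) := by funext s; ring
  rw [hsub, iteratedDeriv_const_add (Nat.succ_pos k)]

end ExpFamily

section FieldDerivatives

variable {d : ℕ}

/-- Gibbs averages at field `t/β` as tilted sums with Jiang–Newman's weights
`exp(β ∑_e σ_e + t ∑_x σ_x)` (`β ≠ 0`). [cite: JiangNewman2023, §1 eq. (1.1)] -/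
theorem isingExpect_eq_sum_exp_div {β : ℝ} (hβ : β ≠ 0) (Λ : Finset (Site d)) (t : ℝ)
    (F : SpinConfig (Site d) → ℝ) :
    isingExpect (zdGraph d) Λ β (t / β) .free F =
      (∑ τ : Λ → ℤˣ, Real.exp (β * ∑ e ∈ edgesIn (zdGraph d) Λ, bondSpin (glue Λ τ .free) e +
          t * ∑ x ∈ Λ, spinAt x (glue Λ τ .free)) * F (glue Λ τ .free)) /
        ∑ τ : Λ → ℤˣ, Real.exp (β * ∑ e ∈ edgesIn (zdGraph d) Λ, bondSpin (glue Λ τ .free) e +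
          t * ∑ x ∈ Λ, spinAt x (glue Λ τ .free)) := by
  have hw : ∀ τ : Λ → ℤˣ, isingWeight (zdGraph d) Λ β (t / β) .free τ =
      Real.exp (β * ∑ e ∈ edgesIn (zdGraph d) Λ, bondSpin (glue Λ τ .free) e +
        t * ∑ x ∈ Λ, spinAt x (glue Λ τ .free)) := by
    intro τ
    rw [isingWeight, isingHamiltonian, interactionEdges_free]
    congr 1
    have : β * (t / β) = t := mul_div_cancel₀ t hβ
    calc -β * (-∑ e ∈ edgesIn (zdGraph d) Λ, bondSpin (glue Λ τ .free) e -
          t / β * ∑ x ∈ Λ, spinAt x (glue Λ τ .free))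
        = β * ∑ e ∈ edgesIn (zdGraph d) Λ, bondSpin (glue Λ τ .free) e +
            β * (t / β) * ∑ x ∈ Λ, spinAt x (glue Λ τ .free) := by ring
      _ = _ := by rw [this]
  rw [isingExpect_eq_sum_div_of_countable, isingPartitionFunction]
  simp_rw [hw]

/-- **The field derivatives of `ln Z_{Λ,β,h}` at any real field are the cumulants of the total
magnetisation under `⟨·⟩^∅_{Λ;β,h/β}`** (JN eqs. (2.2)–(2.3), at every `h`): for `β ≠ 0` and
`n ≥ 1`, `(d/dh)ⁿ ln Z_{Λ,β,h}|_{h=t} = κ_n(M_Λ)` with moments `⟨M_Λᵐ⟩^∅_{Λ;β,t/β}`.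
[cite: JiangNewman2023, §2 eqs. (2.2)–(2.3)] -/
theorem iteratedDeriv_log_partitionFunction_eq_cumulantOf {β : ℝ} (hβ : β ≠ 0)
    (Λ : Finset (Site d)) {n : ℕ} (hn : 1 ≤ n) (t : ℝ) :
    iteratedDeriv n (fun h : ℝ => Real.log (partitionFunction d Λ β h).re) t =
      cumulantOf (fun m => isingExpect (zdGraph d) Λ β (t / β) .free
        (fun σ => (∑ x ∈ Λ, spinAt x σ) ^ m)) n := by
  have hfun : (fun h : ℝ => Real.log (partitionFunction d Λ β h).re) = fun s : ℝ =>
      Real.log (∑ τ : Λ → ℤˣ, Real.exp (β * ∑ e ∈ edgesIn (zdGraph d) Λ, bondSpin (glue Λ τ .free) e +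
        s * ∑ x ∈ Λ, spinAt x (glue Λ τ .free))) :=
    funext fun h => by rw [re_partitionFunction_ofReal]
  rw [hfun, iteratedDeriv_log_sum_exp_eq_cumulantOf _ _ hn t]
  congr 1
  funext m
  rw [isingExpect_eq_sum_exp_div hβ]
  congr 1
  exact sum_congr rfl fun τ _ => by ring

/-- **Uniform bounds on all field derivatives of the finite-volume free energies below `β_c`**
(JN Thm. 2, the input "bounds on the derivatives of `f_{B_n,β}` from [Leb72]"): for `d ≥ 2`,
`0 < β < β_c(d)` and `n ≥ 1` there is `C_n` with `|f_{Λ,β}^{(n)}(h)| ≤ C_n` for every nonempty finite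
`Λ` and every real `h` (Lebowitz 1972, §II: "when the magnitude of each term in the sum on the
right side of (2.4) is bounded in the neighborhood of `h = 0`, uniformly in `Λ` …", eq. (2.7)).
[cite: Lebowitz1972, §II eqs. (2.4)–(2.7)] [cite: JiangNewman2023, Thm. 2] -/
theorem exists_abs_iteratedDeriv_freeEnergyIn_le (hd : 2 ≤ d) {β : ℝ} (hβ : 0 < β)
    (hβc : β < criticalBeta d) {n : ℕ} (hn : 1 ≤ n) :
    ∃ C : ℝ, ∀ (Λ : Finset (Site d)), Λ.Nonempty → ∀ h : ℝ,
      |iteratedDeriv n (freeEnergyIn d Λ β) h| ≤ C := by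
  obtain ⟨C, hC⟩ := exists_abs_cumulantOf_magnetization_le hd hβ.le hβc hn
  refine ⟨C, fun Λ hΛ h => ?_⟩
  have hcard : (0 : ℝ) < Λ.card := by exact_mod_cast card_pos.2 hΛ
  have hfe : freeEnergyIn d Λ β = fun h : ℝ => (Λ.card : ℝ)⁻¹ * Real.log (partitionFunction d Λ β h).re := by
    funext h; rw [freeEnergyIn, div_eq_inv_mul]
  rw [hfe, iteratedDeriv_const_mul_field, iteratedDeriv_log_partitionFunction_eq_cumulantOf hβ.ne' Λ hn,
    abs_mul, abs_inv, abs_of_pos hcard]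
  rw [inv_mul_le_iff₀ hcard, mul_comm]
  exact hC Λ (h / β)

end FieldDerivatives

/-! ### Simon's lemma: pointwise convergence plus uniform bounds on all derivatives gives
convergence of all derivatives (the argument of [Sim93, Lemma II.12.9] used for JN Thm. 2) -/

section UniformDerivatives

/-- A differentiable real function with `|φ'| ≤ K` is `K`-Lipschitz. [folklore] -/
theorem abs_sub_le_of_abs_deriv_le {φ : ℝ → ℝ} (hφ : Differentiable ℝ φ) {K : ℝ}
    (hK : ∀ x, |deriv φ x| ≤ K) (x y : ℝ) : |φ y - φ x| ≤ K * |y - x| := by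
  have h := Convex.norm_image_sub_le_of_norm_deriv_le (s := Set.univ) (fun z _ => hφ z)
    (fun z _ => by rw [Real.norm_eq_abs]; exact hK z) convex_univ (Set.mem_univ x) (Set.mem_univ y)
  simpa only [Real.norm_eq_abs] using h

/-- **Level zero**: an equi-Lipschitz sequence converging pointwise converges uniformly on
compact intervals. [cite: Simon1993, Lemma II.12.9] -/
theorem tendstoUniformlyOn_of_lipschitz_of_tendsto {F : ℕ → ℝ → ℝ} {f : ℝ → ℝ} {K : ℝ} (hK : 0 ≤ K)
    (hF : ∀ m x y, |F m y - F m x| ≤ K * |y - x|)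
    (hlim : ∀ x, Tendsto (fun m => F m x) atTop (𝓝 (f x))) (a b : ℝ) :
    TendstoUniformlyOn F f atTop (Set.Icc a b) := by
  have hf : ∀ x y, |f y - f x| ≤ K * |y - x| := fun x y =>
    le_of_tendsto (((hlim y).sub (hlim x)).abs) (Eventually.of_forall fun m => hF m x y)
  rw [Metric.tendstoUniformlyOn_iff]
  intro ε hε
  set δ : ℝ := ε / (4 * (K + 1)) with hδ
  have hδpos : 0 < δ := by positivity
  have hKδ : K * δ ≤ ε / 4 := by
    rw [hδ]
    rw [show K * (ε / (4 * (K + 1))) = (ε / 4) * (K / (K + 1)) by field_simp]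
    exact mul_le_of_le_one_right (by positivity) ((div_le_one (by positivity)).2 (by linarith))
  set N : ℕ := ⌈(b - a) / δ⌉₊ with hN
  -- pointwise convergence at the net points `a + k δ`, `k ≤ N`
  have hnet : ∀ᶠ m in atTop, ∀ k ∈ range (N + 1), dist (F m (a + k * δ)) (f (a + k * δ)) < ε / 4 :=
    (Finset.eventually_all (range (N + 1))).2 fun k _ =>
      (Metric.tendsto_nhds.1 (hlim (a + k * δ))) (ε / 4) (by positivity)
  filter_upwards [hnet] with m hm x hx
  set k : ℕ := ⌊(x - a) / δ⌋₊ with hk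
  have hxa : 0 ≤ x - a := by linarith [hx.1]
  have hk1 : (k : ℝ) ≤ (x - a) / δ := Nat.floor_le (div_nonneg hxa hδpos.le)
  have hk2 : (x - a) / δ < k + 1 := Nat.lt_floor_add_one _
  have hkN : k ∈ range (N + 1) := by
    rw [Finset.mem_range, Nat.lt_succ_iff, hk, hN]
    exact Nat.floor_le_ceil _ |>.trans (Nat.ceil_mono (div_le_div_of_nonneg_right (by linarith [hx.2]) hδpos.le))
  set y : ℝ := a + k * δ with hy
  have hxy : |x - y| ≤ δ := by
    have h1 : k * δ ≤ x - a := by rwa [le_div_iff₀ hδpos] at hk1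
    have h2 : x - a < (k + 1) * δ := by rwa [div_lt_iff₀ hδpos] at hk2
    rw [abs_le]; constructor <;> nlinarith
  have h1 : |f x - f y| ≤ K * δ := (hf y x).trans (mul_le_mul_of_nonneg_left hxy hK)
  have h2 : |F m x - F m y| ≤ K * δ := (hF m y x).trans (mul_le_mul_of_nonneg_left hxy hK)
  have h3 : |F m y - f y| < ε / 4 := by
    have := hm k hkN; rwa [Real.dist_eq] at this
  rw [Real.dist_eq]
  calc |f x - F m x| = |(f x - f y) - (F m x - F m y) - (F m y - f y)| := by ring_nf
    _ ≤ |f x - f y| + |F m x - F m y| + |F m y - f y| := by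
        exact (abs_sub _ _).trans (add_le_add_left (abs_sub _ _) _)
    _ < ε := by linarith

/-- **The interpolation inequality** `|ψ'(x)| ≤ 2 sup|ψ| / ℓ + L ℓ` for `|ψ''| ≤ L`, in the form
used for two terms of a sequence: if `|ψ| ≤ η` on `[x, x + ℓ]` and `ψ'` is `L`-Lipschitz then
`|ψ'(x)| ≤ 2η/ℓ + L ℓ`. [cite: Simon1993, Lemma II.12.9] -/
theorem abs_deriv_le_of_abs_le {ψ : ℝ → ℝ} (hψ : Differentiable ℝ ψ) {L : ℝ}
    (hL : ∀ x y, |deriv ψ y - deriv ψ x| ≤ L * |y - x|) {x ℓ η : ℝ} (hℓ : 0 < ℓ)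
    (hη : ∀ y ∈ Set.Icc x (x + ℓ), |ψ y| ≤ η) : |deriv ψ x| ≤ 2 * η / ℓ + L * ℓ := by
  obtain ⟨ξ, hξ, hslope⟩ := exists_deriv_eq_slope ψ (show x < x + ℓ by linarith)
    hψ.continuous.continuousOn hψ.differentiableOn
  have h1 : |deriv ψ ξ| ≤ 2 * η / ℓ := by
    rw [hslope, add_sub_cancel_left, abs_div, abs_of_pos hℓ]
    refine div_le_div_of_nonneg_right ?_ hℓ.le
    calc |ψ (x + ℓ) - ψ x| ≤ |ψ (x + ℓ)| + |ψ x| := abs_sub _ _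
      _ ≤ η + η := add_le_add (hη _ ⟨by linarith, le_rfl⟩) (hη _ ⟨le_rfl, by linarith⟩)
      _ = 2 * η := by ring
  have h2 : |deriv ψ x - deriv ψ ξ| ≤ L * ℓ := by
    refine (hL ξ x).trans ?_
    have : |x - ξ| ≤ ℓ := by rw [abs_le]; constructor <;> linarith [hξ.1, hξ.2]
    have hL0 : 0 ≤ L := by
      have := (abs_nonneg _).trans (hL x (x + 1))
      rw [add_sub_cancel_left, abs_one, mul_one] at this; exact this
    exact mul_le_mul_of_nonneg_left this hL0
  calc |deriv ψ x| = |deriv ψ ξ + (deriv ψ x - deriv ψ ξ)| := by ring_nf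
    _ ≤ |deriv ψ ξ| + |deriv ψ x - deriv ψ ξ| := abs_add_le _ _
    _ ≤ 2 * η / ℓ + L * ℓ := add_le_add h1 h2

/-- **From uniform convergence of `g_m` and a uniform bound on `g_m''` to uniform Cauchy-ness of
`g_m'`** on compact intervals. [cite: Simon1993, Lemma II.12.9] -/
theorem uniformCauchySeqOn_deriv {g : ℕ → ℝ → ℝ} (hg : ∀ m, Differentiable ℝ (g m))
    (hg' : ∀ m, Differentiable ℝ (deriv (g m))) {C : ℝ} (hC : ∀ m x, |deriv (deriv (g m)) x| ≤ C)
    (hunif : ∀ a b : ℝ, UniformCauchySeqOn g atTop (Set.Icc a b)) (a b : ℝ) :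
    UniformCauchySeqOn (fun m => deriv (g m)) atTop (Set.Icc a b) := by
  have hC0 : 0 ≤ C := (abs_nonneg _).trans (hC 0 0)
  rw [Metric.uniformCauchySeqOn_iff]
  intro ε hε
  set ℓ : ℝ := min 1 (ε / (8 * (C + 1))) with hℓ
  have hℓpos : 0 < ℓ := lt_min one_pos (by positivity)
  have hℓ1 : ℓ ≤ 1 := min_le_left _ _
  have hCℓ : 2 * C * ℓ ≤ ε / 4 := by
    have : ℓ ≤ ε / (8 * (C + 1)) := min_le_right _ _
    calc 2 * C * ℓ ≤ 2 * C * (ε / (8 * (C + 1))) := mul_le_mul_of_nonneg_left this (by positivity)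
      _ = (ε / 4) * (C / (C + 1)) := by field_simp; ring
      _ ≤ ε / 4 := mul_le_of_le_one_right (by positivity) ((div_le_one (by positivity)).2 (by linarith))
  set η : ℝ := ε * ℓ / 8 with hη
  have hηpos : 0 < η := by positivity
  obtain ⟨N, hN⟩ := (Metric.uniformCauchySeqOn_iff.1 (hunif a (b + 1))) η hηpos
  refine ⟨N, fun m hm k hk x hx => ?_⟩
  -- apply the interpolation inequality to `ψ = g m - g k` on `[x, x + ℓ] ⊆ [a, b + 1]`
  set ψ : ℝ → ℝ := fun y => g m y - g k y with hψ
  have hψd : Differentiable ℝ ψ := (hg m).sub (hg k)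
  have hdψ : deriv ψ = deriv (g m) - deriv (g k) := by
    funext y; exact ((hg m y).hasDerivAt.sub (hg k y).hasDerivAt).deriv
  have hψ'd : Differentiable ℝ (deriv ψ) := by rw [hdψ]; exact (hg' m).sub (hg' k)
  have hddψ : ∀ y, |deriv (deriv ψ) y| ≤ 2 * C := by
    intro y
    rw [hdψ, ((hg' m y).hasDerivAt.sub (hg' k y).hasDerivAt).deriv]
    show |deriv (deriv (g m)) y - deriv (deriv (g k)) y| ≤ 2 * C
    calc |deriv (deriv (g m)) y - deriv (deriv (g k)) y|
        ≤ |deriv (deriv (g m)) y| + |deriv (deriv (g k)) y| := abs_sub _ _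
      _ ≤ C + C := add_le_add (hC m y) (hC k y)
      _ = 2 * C := by ring
  have hLip : ∀ u v, |deriv ψ v - deriv ψ u| ≤ 2 * C * |v - u| :=
    abs_sub_le_of_abs_deriv_le hψ'd hddψ
  have hηb : ∀ y ∈ Set.Icc x (x + ℓ), |ψ y| ≤ η := by
    intro y hy
    have hy' : y ∈ Set.Icc a (b + 1) := ⟨hx.1.trans hy.1, hy.2.trans (by linarith [hx.2])⟩
    have := hN m hm k hk y hy'
    rw [Real.dist_eq] at this
    exact this.le
  have hmain := abs_deriv_le_of_abs_le hψd hLip hℓpos hηb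
  rw [Real.dist_eq, show deriv (g m) x - deriv (g k) x = deriv ψ x by rw [hdψ]; rfl]
  calc |deriv ψ x| ≤ 2 * η / ℓ + 2 * C * ℓ := hmain
    _ = ε / 4 + 2 * C * ℓ := by rw [hη]; field_simp; ring
    _ ≤ ε / 4 + ε / 4 := add_le_add_right hCℓ _
    _ < ε := by linarith

/-- A sequence uniformly Cauchy on every compact interval of `ℝ` converges locally uniformly to
its pointwise limit. [folklore] -/
theorem tendstoLocallyUniformly_of_uniformCauchySeqOn {G : ℕ → ℝ → ℝ}
    (hG : ∀ a b : ℝ, UniformCauchySeqOn G atTop (Set.Icc a b)) :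
    ∃ g : ℝ → ℝ, (∀ x, Tendsto (fun m => G m x) atTop (𝓝 (g x))) ∧
      ∀ a b : ℝ, TendstoUniformlyOn G g atTop (Set.Icc a b) := by
  have hpt : ∀ x, ∃ y, Tendsto (fun m => G m x) atTop (𝓝 y) := by
    intro x
    refine cauchySeq_tendsto_of_complete ?_
    rw [Metric.cauchySeq_iff]
    intro ε hε
    obtain ⟨N, hN⟩ := (Metric.uniformCauchySeqOn_iff.1 (hG x x)) ε hε
    exact ⟨N, fun m hm k hk => hN m hm k hk x ⟨le_rfl, le_rfl⟩⟩
  choose g hg using hpt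
  exact ⟨g, hg, fun a b => (hG a b).tendstoUniformlyOn_of_tendsto fun x _ => hg x⟩

/-- Uniform convergence on all compact intervals is locally uniform convergence on `ℝ`. [folklore] -/
theorem tendstoLocallyUniformlyOn_univ_of_Icc {G : ℕ → ℝ → ℝ} {g : ℝ → ℝ}
    (h : ∀ a b : ℝ, TendstoUniformlyOn G g atTop (Set.Icc a b)) :
    TendstoLocallyUniformlyOn G g atTop Set.univ := by
  rw [tendstoLocallyUniformlyOn_univ, tendstoLocallyUniformly_iff_forall_isCompact]
  intro K hK
  rcases K.eq_empty_or_nonempty with rfl | hne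
  · exact tendstoUniformlyOn_empty
  · exact (h (sInf K) (sSup K)).mono fun x hx =>
      ⟨csInf_le hK.bddBelow hx, le_csSup hK.bddAbove hx⟩

/-- **The inductive step of Simon's lemma**: if `F_m^{(n)} → f^{(n)}` uniformly on compact
intervals and `sup |F_m^{(n+2)}| < ∞`, then `f^{(n)}` is differentiable with derivative
`f^{(n+1)}` and `F_m^{(n+1)} → f^{(n+1)}` uniformly on compact intervals (interpolation inequality,
completeness, and `hasDerivAt_of_tendstoLocallyUniformlyOn`). [cite: Simon1993, Lemma II.12.9] -/
theorem simon_step {F : ℕ → ℝ → ℝ} {f : ℝ → ℝ} (n : ℕ)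
    (hdn : ∀ m, Differentiable ℝ (iteratedDeriv n (F m)))
    (hdn1 : ∀ m, Differentiable ℝ (iteratedDeriv (n + 1) (F m)))
    {C : ℝ} (hC : ∀ m x, |iteratedDeriv (n + 2) (F m) x| ≤ C)
    (hunif : ∀ a b : ℝ, TendstoUniformlyOn (fun m => iteratedDeriv n (F m)) (iteratedDeriv n f) atTop
      (Set.Icc a b)) :
    (∀ x, HasDerivAt (iteratedDeriv n f) (iteratedDeriv (n + 1) f x) x) ∧
      ∀ a b : ℝ, TendstoUniformlyOn (fun m => iteratedDeriv (n + 1) (F m)) (iteratedDeriv (n + 1) f)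
        atTop (Set.Icc a b) := by
  have hcauchy : ∀ a b : ℝ,
      UniformCauchySeqOn (fun m => deriv (iteratedDeriv n (F m))) atTop (Set.Icc a b) := by
    refine uniformCauchySeqOn_deriv hdn (fun m => ?_) (C := C) (fun m x => ?_)
      fun a b => (hunif a b).uniformCauchySeqOn
    · rw [← iteratedDeriv_succ]; exact hdn1 m
    · rw [← iteratedDeriv_succ, ← iteratedDeriv_succ]; exact hC m x
  obtain ⟨G, hGpt, hGunif⟩ := tendstoLocallyUniformly_of_uniformCauchySeqOn hcauchy
  have hloc := tendstoLocallyUniformlyOn_univ_of_Icc hGunif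
  -- the limit `G` is the derivative of `f^{(n)}`
  have hderiv : ∀ x, HasDerivAt (iteratedDeriv n f) (G x) x := fun x =>
    hasDerivAt_of_tendstoLocallyUniformlyOn isOpen_univ hloc
      (Eventually.of_forall fun m y _ => ((hdn m) y).hasDerivAt)
      (fun y _ => (hunif y y).tendsto_at ⟨le_rfl, le_rfl⟩) (Set.mem_univ x)
  have hG : iteratedDeriv (n + 1) f = G := by
    rw [iteratedDeriv_succ]; funext x; exact (hderiv x).deriv
  rw [hG]
  refine ⟨hderiv, fun a b => ?_⟩
  simp_rw [iteratedDeriv_succ]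
  exact hGunif a b

/-- **Simon's lemma** ([Sim93, Lemma II.12.9], the argument behind JN Thm. 2): if smooth
`F_m → f` pointwise on `ℝ` and, for every `n ≥ 1`, `sup_{m,x} |F_m^{(n)}(x)| < ∞`, then for every
`n`, `F_m^{(n)} → f^{(n)}` uniformly on compact intervals. Induction on `n` (`simon_step`), the
level `n = 0` being the equi-Lipschitz case. [cite: Simon1993, Lemma II.12.9] -/
theorem tendstoUniformlyOn_iteratedDeriv_of_bounds {F : ℕ → ℝ → ℝ} {f : ℝ → ℝ}
    (hF : ∀ (m n : ℕ), ContDiff ℝ n (F m))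
    (hb : ∀ n : ℕ, 1 ≤ n → ∃ C, ∀ m x, |iteratedDeriv n (F m) x| ≤ C)
    (hlim : ∀ x, Tendsto (fun m => F m x) atTop (𝓝 (f x))) (n : ℕ) (a b : ℝ) :
    TendstoUniformlyOn (fun m => iteratedDeriv n (F m)) (iteratedDeriv n f) atTop (Set.Icc a b) := by
  have hdiff : ∀ m n, Differentiable ℝ (iteratedDeriv n (F m)) := fun m n =>
    (hF m (n + 1)).differentiable_iteratedDeriv n (by exact_mod_cast Nat.lt_succ_self n)
  induction n generalizing a b with
  | zero =>
    obtain ⟨K, hK⟩ := hb 1 le_rfl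
    have hK0 : 0 ≤ K := (abs_nonneg _).trans (hK 0 0)
    simp only [iteratedDeriv_zero]
    refine tendstoUniformlyOn_of_lipschitz_of_tendsto hK0 (fun m x y => ?_) hlim a b
    refine abs_sub_le_of_abs_deriv_le ?_ (fun z => ?_) x y
    · simpa using hdiff m 0
    · rw [← iteratedDeriv_one]; exact hK m z
  | succ n ih =>
    obtain ⟨C, hC⟩ := hb (n + 2) (by omega)
    exact (simon_step n (fun m => hdiff m n) (fun m => hdiff m (n + 1)) hC ih).2 a b

/-- Pointwise form of Simon's lemma: `F_m^{(n)}(x) → f^{(n)}(x)`. [cite: Simon1993, Lemma II.12.9] -/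
theorem tendsto_iteratedDeriv_of_bounds {F : ℕ → ℝ → ℝ} {f : ℝ → ℝ}
    (hF : ∀ (m n : ℕ), ContDiff ℝ n (F m))
    (hb : ∀ n : ℕ, 1 ≤ n → ∃ C, ∀ m x, |iteratedDeriv n (F m) x| ≤ C)
    (hlim : ∀ x, Tendsto (fun m => F m x) atTop (𝓝 (f x))) (n : ℕ) (x : ℝ) :
    Tendsto (fun m => iteratedDeriv n (F m) x) atTop (𝓝 (iteratedDeriv n f x)) :=
  (tendstoUniformlyOn_iteratedDeriv_of_bounds hF hb hlim n x x).tendsto_at ⟨le_rfl, le_rfl⟩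

/-- Under the hypotheses of Simon's lemma the limit is smooth: every `f^{(n)}` is differentiable
with derivative `f^{(n+1)}`, whence `f ∈ C^∞(ℝ)`. [cite: Simon1993, Lemma II.12.9] -/
theorem contDiff_of_bounds {F : ℕ → ℝ → ℝ} {f : ℝ → ℝ}
    (hF : ∀ (m n : ℕ), ContDiff ℝ n (F m))
    (hb : ∀ n : ℕ, 1 ≤ n → ∃ C, ∀ m x, |iteratedDeriv n (F m) x| ≤ C)
    (hlim : ∀ x, Tendsto (fun m => F m x) atTop (𝓝 (f x))) (n : ℕ) : ContDiff ℝ n f := by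
  have hdiff : ∀ m n, Differentiable ℝ (iteratedDeriv n (F m)) := fun m n =>
    (hF m (n + 1)).differentiable_iteratedDeriv n (by exact_mod_cast Nat.lt_succ_self n)
  refine contDiff_of_differentiable_iteratedDeriv fun k _ => ?_
  obtain ⟨C, hC⟩ := hb (k + 2) (by omega)
  have h := (simon_step k (fun m => hdiff m k) (fun m => hdiff m (k + 1)) hC
    (tendstoUniformlyOn_iteratedDeriv_of_bounds hF hb hlim k)).1
  exact fun x => (h x).differentiableAt

end UniformDerivatives


/-! ### JN Theorem 2 ([Leb72] + [ABF87]): smoothness of `f_β` and convergence of all field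
derivatives of `f_{B_n,β}`, for `β < β_c`; the cumulant-density clause of `FirstZeroLimit` -/

section TheoremTwo

variable (d : ℕ)

/-- `β = 0`: `f_0(h) = ln(e^h + e^{-h})`. [cite: JiangNewman2023, §1 eq. (1.5)] -/
theorem freeEnergy_zero_eq : freeEnergy d 0 = fun h => Real.log (Real.exp h + Real.exp (-h)) := by
  funext h
  refine tendsto_nhds_unique (tendsto_freeEnergyIn_zero d h) ?_
  exact tendsto_const_nhds.congr fun n => (freeEnergyIn_zero d (box_nonempty d n) h).symm

/-- `β = 0`: `u_k(M_{Λ,0,0}) = |Λ| · (d/dh)ᵏ ln(e^h + e^{-h})|₀`. [cite: JiangNewman2023, §2 eq. (2.3)] -/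
theorem magnetizationCumulant_zero_beta (Λ : Finset (Site d)) (k : ℕ) :
    magnetizationCumulant d Λ 0 k =
      (#Λ : ℝ) * iteratedDeriv k (fun h => Real.log (Real.exp h + Real.exp (-h))) 0 := by
  rw [magnetizationCumulant]
  have : (fun h : ℝ => Real.log (partitionFunction d Λ 0 h).re) =
      fun h => (#Λ : ℝ) * Real.log (Real.exp h + Real.exp (-h)) := by
    funext h; rw [partitionFunction_zero_ofReal_re, Real.log_pow]
  rw [this, iteratedDeriv_const_mul_field]

/-- The cumulant-density clause at `β = 0` (a constant sequence). [cite: JiangNewman2023, Prop. 1 with Prop. 3, eq. (2.21)] -/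
theorem tendsto_magnetizationCumulant_div_card_zero_beta (k : ℕ) :
    Tendsto (fun n : ℕ => magnetizationCumulant d (box d n) 0 k / (#(box d n) : ℝ)) atTop
      (𝓝 (iteratedDeriv k (freeEnergy d 0) 0)) := by
  have hc : ∀ n : ℕ, magnetizationCumulant d (box d n) 0 k / (#(box d n) : ℝ) =
      iteratedDeriv k (freeEnergy d 0) 0 := by
    intro n
    have hcard : (#(box d n) : ℝ) ≠ 0 := Nat.cast_ne_zero.2 (card_pos.2 (box_nonempty d n)).ne'
    rw [magnetizationCumulant_zero_beta, freeEnergy_zero_eq, mul_div_cancel_left₀ _ hcard]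
  simp_rw [hc]
  exact tendsto_const_nhds

variable {d}

/-- `h ↦ f_{Λ,β}(h)` is smooth. [folklore] -/
theorem contDiff_freeEnergyIn (Λ : Finset (Site d)) (β : ℝ) (n : ℕ) : ContDiff ℝ n (freeEnergyIn d Λ β) := by
  have : freeEnergyIn d Λ β = fun h : ℝ => (#Λ : ℝ)⁻¹ * Real.log (partitionFunction d Λ β h).re := by
    funext h; rw [freeEnergyIn, div_eq_inv_mul]
  rw [this]
  exact contDiff_const.mul (contDiff_log_re_partitionFunction Λ β n)

/-- `f_{Λ,β}^{(k)}(0) = u_k(M_{Λ,β,0}) / |Λ|` (JN (2.4)). [cite: JiangNewman2023, §2 eq. (2.4)] -/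
theorem iteratedDeriv_freeEnergyIn_zero_eq (Λ : Finset (Site d)) (β : ℝ) (k : ℕ) :
    iteratedDeriv k (freeEnergyIn d Λ β) 0 = magnetizationCumulant d Λ β k / (#Λ : ℝ) := by
  have : freeEnergyIn d Λ β = fun h : ℝ => (#Λ : ℝ)⁻¹ * Real.log (partitionFunction d Λ β h).re := by
    funext h; rw [freeEnergyIn, div_eq_inv_mul]
  rw [this, iteratedDeriv_const_mul_field, magnetizationCumulant, div_eq_inv_mul]

/-- **JN Theorem 2 ([Leb72] and [ABF87]), convergence of derivatives**: for `d ≥ 2` and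
`0 < β < β_c(d)`, for every `k`, `f_{B_n,β}^{(k)} → f_β^{(k)}` uniformly on compact intervals of
`ℝ` (pointwise convergence of `f_{B_n,β}`, Friedli–Velenik Thm. 3.6, plus Lebowitz's uniform
derivative bounds `exists_abs_iteratedDeriv_freeEnergyIn_le`, through Simon's Lemma II.12.9).
[cite: JiangNewman2023, Thm. 2] -/
theorem tendstoUniformlyOn_iteratedDeriv_freeEnergyIn (hd : 2 ≤ d) {β : ℝ} (hβ : 0 < β)
    (hβc : β < criticalBeta d) (k : ℕ) (a b : ℝ) :
    TendstoUniformlyOn (fun m : ℕ => iteratedDeriv k (freeEnergyIn d (box d m) β))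
      (iteratedDeriv k (freeEnergy d β)) atTop (Set.Icc a b) :=
  tendstoUniformlyOn_iteratedDeriv_of_bounds (F := fun m => freeEnergyIn d (box d m) β)
    (f := freeEnergy d β) (fun m n => contDiff_freeEnergyIn _ _ n)
    (fun n hn => by
      obtain ⟨C, hC⟩ := exists_abs_iteratedDeriv_freeEnergyIn_le hd hβ hβc hn
      exact ⟨C, fun m x => hC _ (box_nonempty d m) x⟩)
    (tendsto_freeEnergyIn d β) k a b

/-- **JN Theorem 2 ([Leb72] and [ABF87]), smoothness**: for `d ≥ 2` and `0 < β < β_c(d)` the free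
energy `f_β` is infinitely differentiable on `ℝ`. [cite: JiangNewman2023, Thm. 2] -/
theorem contDiff_freeEnergy (hd : 2 ≤ d) {β : ℝ} (hβ : 0 < β) (hβc : β < criticalBeta d) (n : ℕ) :
    ContDiff ℝ n (freeEnergy d β) :=
  contDiff_of_bounds (F := fun m => freeEnergyIn d (box d m) β) (f := freeEnergy d β)
    (fun m n => contDiff_freeEnergyIn _ _ n)
    (fun n hn => by
      obtain ⟨C, hC⟩ := exists_abs_iteratedDeriv_freeEnergyIn_le hd hβ hβc hn
      exact ⟨C, fun m x => hC _ (box_nonempty d m) x⟩)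
    (tendsto_freeEnergyIn d β) n

/-- **The cumulant-density clause of `FirstZeroLimit`, proved** (JN Prop. 1 with Prop. 3,
eq. (2.21): `f_β^{(k)}(0) = lim_n u_k(M_{B_n,β,0})/|B_n|`, here via Thm. 2 directly): for `d ≥ 2`,
`0 ≤ β < β_c(d)` and every `k`, `u_k(M_{B_n,β,0})/|B_n| → f_β^{(k)}(0)`.
[cite: JiangNewman2023, Prop. 3, eq. (2.21), with Thm. 2] -/
theorem tendsto_magnetizationCumulant_div_card_of_lt_criticalBeta (hd : 2 ≤ d) {β : ℝ} (hβ : 0 ≤ β)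
    (hβc : β < criticalBeta d) (k : ℕ) :
    Tendsto (fun n : ℕ => magnetizationCumulant d (box d n) β k / (#(box d n) : ℝ)) atTop
      (𝓝 (iteratedDeriv k (freeEnergy d β) 0)) := by
  rcases hβ.eq_or_lt with h0 | hβpos
  · rw [← h0]; exact tendsto_magnetizationCumulant_div_card_zero_beta d k
  · refine ((tendstoUniformlyOn_iteratedDeriv_freeEnergyIn hd hβpos hβc k 0 0).tendsto_at
      ⟨le_rfl, le_rfl⟩).congr fun m => ?_
    exact iteratedDeriv_freeEnergyIn_zero_eq _ β k

/-- **`FirstZeroLimit` from its two remaining printed inputs**: Camia–Jiang–Newman's Theorem 1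
(the tree's named fact `CamiaJiangNewman2023_thm1`) and Ott's analyticity of `f_β` at `h = 0` for
`β < β_c` ([Ott20, Cor. 1.4], here the hypothesis `hOtt`); the third printed input, JN Theorem 2
([Leb72] + [ABF87]), is now the tree theorem `tendsto_magnetizationCumulant_div_card_of_lt_criticalBeta`.
[cite: JiangNewman2023, Thm. 1 (proof, §2: Props. 1–3, Thm. 2, Lemma 1)] -/
theorem firstZeroLimit_of_thm1_of_analytic (h1 : CamiaJiangNewman2023_thm1)
    (hOtt : ∀ d : ℕ, 2 ≤ d → ∀ β : ℝ, 0 ≤ β → β < criticalBeta d →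
      ∃ ρ : ℝ, 0 < ρ ∧ AnalyticOnDisc d β ρ) :
    FirstZeroLimit :=
  firstZeroLimit_of_thm1_of_analytic_of_tendsto h1 hOtt fun _ hd _ hβ hβc k _ =>
    tendsto_magnetizationCumulant_div_card_of_lt_criticalBeta hd hβ hβc (2 * k)

end TheoremTwo

/-! ## The analyticity input in Mathlib's vocabulary: `AnalyticOnDisc` versus `AnalyticAt ℝ`

The remaining analytic input of JN Theorem 1 is [Ott20, Cor. 1.4]: for `d ≥ 1` and `β < β_c(d)` the
pressure is analytic in a neighbourhood of `(β, 0)`. We record that the form in which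
`firstZeroLimit_of_thm1_of_analytic` consumes it — `∃ ρ > 0, AnalyticOnDisc d β ρ`, a holomorphic
extension of `f_β` to a complex disc — is equivalent to plain real analyticity of `h ↦ f_β(h)` at
`h = 0` (`AnalyticAt ℝ`), and restate the reduction with that hypothesis (and with the joint
analyticity in `(β, h)` that Ott's corollary literally asserts). -/

section AnalyticInput

variable (d : ℕ)

/-- **Complexification of a real analytic germ.** A real function that is real analytic at `0`
is, near `0`, the trace on the real axis of a function holomorphic on a complex disc about `0`: if
`f(t) = ∑ aₙ tⁿ` on `|t| < r`, then `F(z) = ∑ aₙ zⁿ` is holomorphic on `|z| < ρ` for `ρ < r` and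
`F(t) = f(t)` for real `|t| < ρ`. [folklore] -/
theorem exists_differentiableOn_ball_of_analyticAt {f : ℝ → ℝ} (hf : AnalyticAt ℝ f 0) :
    ∃ ρ : ℝ, 0 < ρ ∧ ∃ F : ℂ → ℂ, DifferentiableOn ℂ F (Metric.ball 0 ρ) ∧
      ∀ t : ℝ, |t| < ρ → F t = f t := by
  obtain ⟨p, r, hp⟩ := hf
  obtain ⟨ρ, hρ0, hρr⟩ : ∃ ρ : NNReal, 0 < ρ ∧ (ρ : ENNReal) < r := by
    obtain ⟨ρ, h0, hr⟩ := ENNReal.lt_iff_exists_nnreal_btwn.mp hp.r_pos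
    exact ⟨ρ, by exact_mod_cast h0, hr⟩
  have hρrad : (ρ : ENNReal) < p.radius := lt_of_lt_of_le hρr hp.r_le
  have hsum : Summable fun n : ℕ => ‖p n‖ * (ρ : ℝ) ^ n := p.summable_norm_mul_pow hρrad
  refine ⟨ρ, by exact_mod_cast hρ0, fun z => ∑' n : ℕ, (p.coeff n : ℂ) * z ^ n, ?_, ?_⟩
  · refine Complex.differentiableOn_tsum_of_summable_norm hsum (fun n => ?_) Metric.isOpen_ball
      (fun n z hz => ?_)
    · exact ((differentiable_id.pow n).const_mul _).differentiableOn
    · rw [Metric.mem_ball, dist_zero_right] at hz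
      rw [norm_mul, norm_pow, Complex.norm_real, ← FormalMultilinearSeries.norm_apply_eq_norm_coef]
      exact mul_le_mul_of_nonneg_left (pow_le_pow_left₀ (norm_nonneg _) hz.le n) (norm_nonneg _)
  · intro t ht
    have hty : (t : ℝ) ∈ Metric.eball (0 : ℝ) r := by
      rw [mem_eball_zero_iff, enorm_eq_nnnorm]
      have htρ : ‖t‖₊ < ρ := by
        rw [← NNReal.coe_lt_coe, coe_nnnorm, Real.norm_eq_abs]
        exact ht
      exact lt_trans (ENNReal.coe_lt_coe.mpr htρ) hρr
    have hs := hp.hasSum hty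
    rw [zero_add] at hs
    have hs' : HasSum (fun n : ℕ => t ^ n * p.coeff n) (f t) := by
      simpa only [FormalMultilinearSeries.apply_eq_pow_smul_coeff, smul_eq_mul] using hs
    have hsC : HasSum (fun n : ℕ => ((t ^ n * p.coeff n : ℝ) : ℂ)) (f t : ℂ) :=
      Complex.hasSum_ofReal.mpr hs'
    have hfun : (fun n : ℕ => (p.coeff n : ℂ) * (t : ℂ) ^ n) =
        fun n : ℕ => ((t ^ n * p.coeff n : ℝ) : ℂ) := by
      funext n
      push_cast
      ring
    show ∑' n : ℕ, (p.coeff n : ℂ) * (t : ℂ) ^ n = (f t : ℂ)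
    rw [hfun]
    exact hsC.tsum_eq

/-- **Restriction of a holomorphic extension.** If `F` is holomorphic on the complex disc
`|z| < ρ`, `ρ > 0`, and agrees with the real function `f` on the real diameter, then `f` is real
analytic at `0` (`f = re ∘ F ∘ (ℝ ↪ ℂ)` near `0`, a composition of analytic maps). [folklore] -/
theorem analyticAt_of_differentiableOn_ball {f : ℝ → ℝ} {ρ : ℝ} (hρ : 0 < ρ) {F : ℂ → ℂ}
    (hF : DifferentiableOn ℂ F (Metric.ball 0 ρ)) (hFf : ∀ t : ℝ, |t| < ρ → F t = f t) :
    AnalyticAt ℝ f 0 := by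
  have hF0 : AnalyticAt ℂ F ((Complex.ofRealCLM : ℝ → ℂ) 0) := by
    rw [Complex.ofRealCLM_apply, Complex.ofReal_zero]
    exact hF.analyticAt (Metric.ball_mem_nhds 0 hρ)
  have hG : AnalyticAt ℝ (fun t : ℝ => Complex.reCLM (F (Complex.ofRealCLM t))) 0 :=
    (Complex.reCLM.analyticAt _).comp (hF0.restrictScalars.comp (Complex.ofRealCLM.analyticAt 0))
  refine hG.congr ?_
  have hball : Metric.ball (0 : ℝ) ρ ∈ 𝓝 (0 : ℝ) := Metric.ball_mem_nhds 0 hρ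
  filter_upwards [hball] with t ht
  rw [Metric.mem_ball, dist_zero_right, Real.norm_eq_abs] at ht
  simp only [Complex.reCLM_apply, Complex.ofRealCLM_apply, hFf t ht, Complex.ofReal_re]

/-- `AnalyticOnDisc d β ρ` for some `ρ > 0` **iff** `h ↦ f_β(h)` is real analytic at `h = 0`: the
analyticity input of JN Prop. 3 ([Ott20, Cor. 1.4]) in Mathlib's vocabulary. [folklore] -/
theorem exists_analyticOnDisc_iff_analyticAt (β : ℝ) :
    (∃ ρ : ℝ, 0 < ρ ∧ AnalyticOnDisc d β ρ) ↔ AnalyticAt ℝ (fun h : ℝ => freeEnergy d β h) 0 := by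
  constructor
  · rintro ⟨ρ, hρ, F, hF, hFf⟩
    exact analyticAt_of_differentiableOn_ball hρ hF hFf
  · intro h
    obtain ⟨ρ, hρ, F, hF, hFf⟩ := exists_differentiableOn_ball_of_analyticAt h
    exact ⟨ρ, hρ, F, hF, hFf⟩

/-- Joint real analyticity of the pressure `(β', h) ↦ f_{β'}(h)` at `(β, 0)` ([Ott20, Cor. 1.4] as
printed: "`P` is analytic in a neighbourhood of `(β, h)`") gives real analyticity of the slice
`h ↦ f_β(h)` at `0` (composition with the analytic map `h ↦ (β, h)`). [folklore] -/
theorem analyticAt_freeEnergy_of_analyticAt₂ {β : ℝ}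
    (h : AnalyticAt ℝ (fun p : ℝ × ℝ => freeEnergy d p.1 p.2) (β, 0)) :
    AnalyticAt ℝ (fun t : ℝ => freeEnergy d β t) 0 :=
  h.comp₂ analyticAt_const analyticAt_id

variable {d}

/-- **`FirstZeroLimit` from Camia–Jiang–Newman's Theorem 1 and the real analyticity of `f_β` at
`h = 0` for `0 ≤ β < β_c(d)`** (the `h`-slice of [Ott20, Cor. 1.4], in Mathlib's `AnalyticAt ℝ`):
`firstZeroLimit_of_thm1_of_analytic` through `exists_analyticOnDisc_iff_analyticAt`.
[cite: JiangNewman2023, Thm. 1 (proof, §2: Props. 1–3, Thm. 2, Lemma 1)] -/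
theorem firstZeroLimit_of_thm1_of_analyticAt (h1 : CamiaJiangNewman2023_thm1)
    (hA : ∀ d : ℕ, 2 ≤ d → ∀ β : ℝ, 0 ≤ β → β < criticalBeta d →
      AnalyticAt ℝ (fun h : ℝ => freeEnergy d β h) 0) :
    FirstZeroLimit :=
  firstZeroLimit_of_thm1_of_analytic h1 fun d hd β hβ hβc =>
    (exists_analyticOnDisc_iff_analyticAt d β).mpr (hA d hd β hβ hβc)

/-- **`FirstZeroLimit` from Camia–Jiang–Newman's Theorem 1 and [Ott20, Cor. 1.4] as printed**: for
`d ≥ 2` (Ott: `d ≥ 1`) and `0 ≤ β < β_c(d)` the pressure `(β', h) ↦ f_{β'}(h)` — Ott's `P(β', h)`,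
same normalisation of the field — is (jointly, real) analytic in a neighbourhood of `(β, 0)`.
[cite: JiangNewman2023, Thm. 1 (proof, §2: Props. 1–3, Thm. 2, Lemma 1)] -/
theorem firstZeroLimit_of_thm1_of_analyticAt₂ (h1 : CamiaJiangNewman2023_thm1)
    (hOtt : ∀ d : ℕ, 2 ≤ d → ∀ β : ℝ, 0 ≤ β → β < criticalBeta d →
      AnalyticAt ℝ (fun p : ℝ × ℝ => freeEnergy d p.1 p.2) (β, 0)) :
    FirstZeroLimit :=
  firstZeroLimit_of_thm1_of_analyticAt h1 fun d hd β hβ hβc =>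
    analyticAt_freeEnergy_of_analyticAt₂ d (hOtt d hd β hβ hβc)

/-- **Sharpness of the analytic input.** Conversely, `FirstZeroLimit` returns the real analyticity
of `h ↦ f_β(h)` at `h = 0` for `d ≥ 2`, `0 ≤ β < β_c(d)` (clauses (ii)–(iii): `a > 0` and `f_β`
extends holomorphically to `|h| < a`). Relies on: hypothesis `h` (the named fact).
[cite: JiangNewman2023, Thm. 1 with Prop. 3] -/
theorem _root_.Literature.Probability.LatticeModels.JiangNewman.FirstZeroLimit.analyticAt_freeEnergy
    (h : FirstZeroLimit) {d : ℕ} (hd : 2 ≤ d) {β : ℝ} (hβ : 0 ≤ β) (hβc : β < criticalBeta d) :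
    AnalyticAt ℝ (fun t : ℝ => freeEnergy d β t) 0 := by
  obtain ⟨-, -, a, -, -, hana, -, hpos, -⟩ := h d hd β hβ
  have ha : 0 < a := hpos.mpr hβc
  exact (exists_analyticOnDisc_iff_analyticAt d β).mp ⟨a, ha, hana a ha le_rfl⟩

end AnalyticInput

end JiangNewman

end Literature.Probability.LatticeModels
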